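import Literature.AlgebraicGeometry.Motives.HodgeThetaSubalgebraUnitaryRaisingRankPsi
import HarnessLib

/-!
# The raising-rank lemma at `dim P = r + 1`, triple route: a Jordan-triple system and its rank identity
# (Ribet 1983 Thm. 3, Lie step; classification-free replacement of Serre's minuscule-weight lemma at maximal rank `dim P − 1`)

Family `hodge`, layer `Literature/AlgebraicGeometry/Motives` (pure linear algebra over `ℂ`; no geometry). Research
context: cell `pub-hodge-ring2` (HONEST FRAMING: research route conditional on HC_CM; not a corollary; Q11.4-sentence-2
already refuted in dim ≥ 3), Literature lane gen 84, programme R66. UNCONDITIONAL; theorems only, no definition, no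
named fact (D-0026), no `sorry`. Companion of `HodgeThetaSubalgebraUnitaryRaisingRank` (Φ-route) and
`HodgeThetaSubalgebraUnitaryRaisingRankPsi` (Ψ-routes). Those three lemmas leave exactly one configuration open: a
raising operator `B` of maximal rank `r = dim P − 1` with `m := dim Q − r ≤ C(r,2)` (lit-g83 README, frontier (a⁗):
the base cores `(5|6)`, `(5|8)` sit at `r = 4`, `m = 2, 4`). This file closes it by a RANK IDENTITY: such a
configuration forces `m (r + 1 − ρ) = r ρ` for an integer `1 ≤ ρ ≤ r − 1`; for `r = 4` only `m ∈ {1, 6}` survive,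
so `(5|6)` and `(5|8)` get a raising operator onto `P` (sequel file `HodgeThetaSubalgebraUnitaryFiveCoreAll`).

THE ARGUMENT (new; numerically validated on the proper 3-graded examples `gl_n ↷ Λ²ℂⁿ`, where `r = n − 2`,
`m = C(r,2)`, `ρ = r − 1` do satisfy the identity). Setting of the unitary cores, with the Hermitian form `s` moreover
`ℂ`-homogeneous in the first slot (true for the Hodge–Riemann form `i ψ_ℂ(x, conj y)` of the sockets). At maximal rank
`r`, with `C = B†`, the projector pair `D`, (★) and (♣) as in the Φ/Ψ files, `P₀ = P ∩ ker C = ℂη`, `σ = s(η,η)`: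
* the Levi instance on `{2D − Θ = −1} = P₀ ⊕ Q₁` (type `(1 | r)`, solved by the `(m,1)` core) gives for EVERY `u ∈ Q₁`
  a raising `B_u ∈ 𝔊` with `B_u|_{Q₁} = s(·, u) η`; its adjoint `C_u = B_u†` satisfies `C_u η = σ u` and maps `P₁`
  into `Q₀`; a raising operator of `𝔊` killing `Q₁` kills `Q₀` ((♣) + covering);
* the double commutator `[[B_u, C_w], B_v] ∈ 𝔊` is raising, and comparing its values on `Q₁` and `Q₀` gives the
  TRIPLE RELATION `B_u C_w B_v + B_v C_w B_u = σ s(w,u) B_v + σ s(w,v) B_u` on `Q₀` — i.e. `u ↦ B_u|_{Q₀}` is a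
  (conjugate-linear) homomorphism of the rank-one Hermitian Jordan triple `Q₁` into `Hom(Q₀, P₁)`;
* with an `s`-orthogonal basis `uⱼ` of `Q₁` (Gram–Schmidt, `§1`) and `κⱼ = (σ s(uⱼ,uⱼ))⁻¹`, the operators
  `G = Σ κⱼ C_{uⱼ} B_{uⱼ}` on `Q₀` and `N = Σ κⱼ B_{uⱼ} C_{uⱼ}` on `P₁` satisfy `N B_u + B_u G = (r+1) B_u`; an
  eigenvector argument (eigenvalue `γ` of `G`; the skew relation (♣) `s(B_v q, B u) = −s(B_u q, B v)`; the adjoint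
  identity `C_u N + G C_u = (r+1) C_u`; anisotropy of `s`; the covering lemma) shows `N = (r+1−γ)·1` and `G = γ·1`;
* `§2` (`UnitaryTriple.rank_identity`, abstract): the idempotents `Eⱼ = κⱼ C_{uⱼ} B_{uⱼ}` have a common rank `ρ`
  (`tr(E′ⱼE′_k) + tr(E_kEⱼ) = ρ_k` is symmetric in `j, k`), and traces give `γ m = r ρ = (r+1−γ) r`, whence
  `m (r + 1 − ρ) = r ρ`, `1 ≤ ρ ≤ r − 1` (`B_{u₀}(Q₀) ⊥ B u₀`).

THE THEOREMS. `UnitaryTriple.exists_orthogonal_basis` (§1), `UnitaryTriple.rank_identity` (§2),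
**`UnitaryRaisingRank.exists_raise_rank_gt_of_finrank_eq_succ_of_smul`** (§3): `dim P = r + 1`, `r ≥ 2`,
`dim Q > r`, and no integer `1 ≤ ρ < r` with `(dim Q − r)(r + 1 − ρ) = r ρ` ⟹ a raising operator of rank `> r`.

## References
* [Ribet1983] K. A. Ribet, Amer. J. Math. 105 (1983), Thm. 3 (= [Gordon1997, Thm. 6.3 (3)], pp. 18–19).
* [Deligne1982HodgeCycles] P. Deligne, LNM 900 (1982), I §3 Prop. 3.4, 3.6.
* [GoodmanWallachGTM255] R. Goodman, N. R. Wallach, GTM 255 (2009), §4.1.1.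
* [HoffmanKunze1971LinearAlgebra] K. Hoffman, R. Kunze, *Linear Algebra* (1971), §6.7 (projections), §8.1–8.2
  (inner products; Thm. 3, Gram–Schmidt, p. 280).
-/

noncomputable section

namespace Literature.AlgebraicGeometry.Motives

namespace HodgeStructure

universe u

variable {W : Type u} [AddCommGroup W] [Module ℂ W]

/-! ### §0 Sesquilinear helpers -/

/-- Conjugate-homogeneity in the second slot of a Hermitian form homogeneous in the first slot.
[cite: HoffmanKunze1971LinearAlgebra, §8.1 (inner products: conjugate-linearity in the second variable)] -/
theorem UnitaryTriple.smul_right {s : W → W → ℂ} (hsmul : ∀ (c : ℂ) (x y : W), s (c • x) y = c * s x y)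
    (hsymm : ∀ x y, s y x = starRingEnd ℂ (s x y)) (c : ℂ) (x y : W) :
    s x (c • y) = starRingEnd ℂ c * s x y := by
  rw [hsymm, hsmul, map_mul, ← hsymm]

omit [Module ℂ W] in
/-- Additivity of a bi-additive form over finite sums, first slot.
[cite: HoffmanKunze1971LinearAlgebra, §8.1 (inner products, linearity)] -/
theorem UnitaryTriple.sum_left {s : W → W → ℂ} (hadd : ∀ x y z, s (x + y) z = s x z + s y z)
    (hsymm : ∀ x y, s y x = starRingEnd ℂ (s x y)) {ι : Type*} (t : Finset ι) (f : ι → W) (y : W) :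
    s (∑ i ∈ t, f i) y = ∑ i ∈ t, s (f i) y := by
  classical
  obtain ⟨-, -, h0l, -, -, -, -⟩ := UnitaryTwoOdd.herm_right hadd hsymm
  induction t using Finset.induction_on with
  | empty => rw [Finset.sum_empty, Finset.sum_empty, h0l]
  | insert a t ha ih => rw [Finset.sum_insert ha, Finset.sum_insert ha, hadd, ih]

omit [Module ℂ W] in
/-- Additivity of a bi-additive form over finite sums, second slot.
[cite: HoffmanKunze1971LinearAlgebra, §8.1 (inner products, linearity)] -/
theorem UnitaryTriple.sum_right {s : W → W → ℂ} (hadd : ∀ x y z, s (x + y) z = s x z + s y z)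
    (hsymm : ∀ x y, s y x = starRingEnd ℂ (s x y)) {ι : Type*} (t : Finset ι) (f : ι → W) (x : W) :
    s x (∑ i ∈ t, f i) = ∑ i ∈ t, s x (f i) := by
  classical
  obtain ⟨haddr, h0r, -, -, -, -, -⟩ := UnitaryTwoOdd.herm_right hadd hsymm
  induction t using Finset.induction_on with
  | empty => rw [Finset.sum_empty, Finset.sum_empty, h0r]
  | insert a t ha ih => rw [Finset.sum_insert ha, Finset.sum_insert ha, haddr, ih]

/-- `x² = 1 ⟹ (−x)² = 1` in a ring (the involution `−ι` of a Levi instance).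
[cite: HoffmanKunze1971LinearAlgebra, §6.7 (involutions and projections)] -/
theorem UnitaryTriple.neg_mul_neg_eq_one_of {R : Type*} [Ring R] {x : R} (h : x * x = 1) : (-x) * (-x) = 1 := by
  rw [neg_mul_neg, h]

/-! ### §1 Gram–Schmidt for an anisotropic Hermitian form on a finite-dimensional subspace -/

/-- **Orthogonal bases (Gram–Schmidt) for an anisotropic Hermitian sesquilinear form.** If `s` is additive and
`ℂ`-homogeneous in the first slot, Hermitian, and anisotropic on the finite-dimensional subspace `S`
(`s x x = 0 → x = 0` on `S`), then `S` has a basis `e₀, …, e_{n−1}` (`n = dim S`) with `s(eⱼ, e_k) = 0` for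
`j ≠ k`, `s(eⱼ, eⱼ) ≠ 0`, and every `x ∈ S` expands as `x = Σⱼ s(eⱼ,eⱼ)⁻¹ s(x, eⱼ) eⱼ`. (No positivity is
assumed; the diagonal values are non-zero reals of either sign.)
[cite: HoffmanKunze1971LinearAlgebra, §8.2 Thm. 3 and its Corollary (Gram–Schmidt process, p. 280)] -/
theorem UnitaryTriple.exists_orthogonal_basis [FiniteDimensional ℂ W] {s : W → W → ℂ}
    (hadd : ∀ x y z, s (x + y) z = s x z + s y z) (hsmul : ∀ (c : ℂ) (x y : W), s (c • x) y = c * s x y)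
    (hsymm : ∀ x y, s y x = starRingEnd ℂ (s x y)) (n : ℕ) :
    ∀ (S : Submodule ℂ W), Module.finrank ℂ S = n → (∀ x ∈ S, s x x = 0 → x = 0) →
      ∃ e : Fin n → W, (∀ j, e j ∈ S) ∧ (∀ j k, j ≠ k → s (e j) (e k) = 0) ∧ (∀ j, s (e j) (e j) ≠ 0) ∧
        ∀ x ∈ S, x = ∑ j, ((s (e j) (e j))⁻¹ * s x (e j)) • e j := by
  classical
  obtain ⟨haddr, h0r, h0l, hnegr, hnegl, hsubr, hsubl⟩ := UnitaryTwoOdd.herm_right hadd hsymm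
  induction n with
  | zero =>
    intro S hS hdef
    refine ⟨fun j => Fin.elim0 j, fun j => Fin.elim0 j, fun j => Fin.elim0 j, fun j => Fin.elim0 j,
      fun x hx => ?_⟩
    have hbot : S = ⊥ := Submodule.finrank_eq_zero.1 hS
    rw [hbot, Submodule.mem_bot] at hx
    rw [hx, Finset.univ_eq_empty, Finset.sum_empty]
  | succ n ih =>
    intro S hS hdef
    obtain ⟨⟨x₀, hx₀S⟩, hx₀⟩ :=
      Module.finrank_pos_iff_exists_ne_zero.1 (show 0 < Module.finrank ℂ S by omega)
    have hx₀' : x₀ ≠ 0 := fun h => hx₀ (Subtype.ext h)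
    have hτ0 : s x₀ x₀ ≠ 0 := fun h => hx₀' (hdef x₀ hx₀S h)
    -- the linear functional `ℓ = s(·, x₀)` and `S' = S ∩ ker ℓ`
    set ℓ : W →ₗ[ℂ] ℂ :=
      { toFun := fun x => s x x₀
        map_add' := fun x y => hadd x y x₀
        map_smul' := fun c x => by rw [hsmul, smul_eq_mul, RingHom.id_apply] } with hℓdef
    have hℓ : ∀ x, ℓ x = s x x₀ := fun x => rfl
    set S' : Submodule ℂ W := S ⊓ LinearMap.ker ℓ with hS'def
    have hS'le : S' ≤ S := inf_le_left
    have hS'mem : ∀ x, x ∈ S' ↔ x ∈ S ∧ s x x₀ = 0 := fun x => by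
      rw [hS'def, Submodule.mem_inf, LinearMap.mem_ker, hℓ]
    have hproj : ∀ x ∈ S, x - ((s x₀ x₀)⁻¹ * s x x₀) • x₀ ∈ S' := fun x hx => by
      rw [hS'mem]
      refine ⟨Submodule.sub_mem _ hx (Submodule.smul_mem _ _ hx₀S), ?_⟩
      rw [hsubl, hsmul, mul_right_comm, inv_mul_cancel₀ hτ0, one_mul, sub_self]
    have hsup : S' ⊔ (ℂ ∙ x₀) = S := by
      apply le_antisymm (sup_le hS'le ((Submodule.span_singleton_le_iff_mem _ _).2 hx₀S))
      intro x hx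
      rw [← sub_add_cancel x (((s x₀ x₀)⁻¹ * s x x₀) • x₀)]
      exact Submodule.add_mem _ (Submodule.mem_sup_left (hproj x hx))
        (Submodule.mem_sup_right (Submodule.smul_mem _ _ (Submodule.mem_span_singleton_self x₀)))
    have hinf : S' ⊓ (ℂ ∙ x₀) = ⊥ := by
      rw [eq_bot_iff]
      rintro y ⟨hy1, hy2⟩
      rw [Submodule.mem_bot]
      obtain ⟨c, rfl⟩ := Submodule.mem_span_singleton.1 hy2
      have h := ((hS'mem _).1 hy1).2
      rw [hsmul, mul_eq_zero] at h
      rcases h with h | h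
      · rw [h, zero_smul]
      · exact absurd h hτ0
    have hfinS' : Module.finrank ℂ S' = n := by
      have h := Submodule.finrank_sup_add_finrank_inf_eq S' (ℂ ∙ x₀)
      rw [hsup, hinf, finrank_bot, add_zero, finrank_span_singleton hx₀', hS] at h
      omega
    obtain ⟨e', he'S, he'orth, he'ne, he'span⟩ := ih S' hfinS' (fun x hx h => hdef x (hS'le hx) h)
    have he'x₀ : ∀ i, s (e' i) x₀ = 0 := fun i => ((hS'mem _).1 (he'S i)).2
    have hx₀e' : ∀ i, s x₀ (e' i) = 0 := fun i => by rw [hsymm, he'x₀ i, map_zero]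
    refine ⟨Fin.cons x₀ e', fun j => ?_, fun j k hjk => ?_, fun j => ?_, fun x hx => ?_⟩
    · refine Fin.cases ?_ (fun i => ?_) j
      · rw [Fin.cons_zero]; exact hx₀S
      · rw [Fin.cons_succ]; exact hS'le (he'S i)
    · revert hjk
      refine Fin.cases ?_ (fun i => ?_) j <;> refine Fin.cases ?_ (fun i' => ?_) k
      · intro h; exact absurd rfl h
      · intro _; rw [Fin.cons_zero, Fin.cons_succ]; exact hx₀e' i'
      · intro _; rw [Fin.cons_zero, Fin.cons_succ]; exact he'x₀ i
      · intro h; rw [Fin.cons_succ, Fin.cons_succ]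
        exact he'orth i i' (fun hii' => h (by rw [hii']))
    · refine Fin.cases ?_ (fun i => ?_) j
      · rw [Fin.cons_zero]; exact hτ0
      · rw [Fin.cons_succ]; exact he'ne i
    · have hx' := he'span _ (hproj x hx)
      have hcoef : ∀ i, s (x - ((s x₀ x₀)⁻¹ * s x x₀) • x₀) (e' i) = s x (e' i) := fun i => by
        rw [hsubl, hsmul, hx₀e' i, mul_zero, sub_zero]
      simp only [hcoef] at hx'
      rw [Fin.sum_univ_succ]
      simp only [Fin.cons_zero, Fin.cons_succ]
      rw [← hx', add_sub_cancel]

/-! ### §2 The rank identity of a Hilbertian triple system (abstract linear algebra) -/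

/-- `tr(x y x' y') = tr(x' y' x y)` for linear maps between two spaces (cyclicity of the trace).
[cite: HoffmanKunze1971LinearAlgebra, §6.7 and §3.4 Exercise (trace of a product is symmetric)] -/
theorem UnitaryTriple.trace_cycl {A B : Type*} [AddCommGroup A] [Module ℂ A] [FiniteDimensional ℂ A]
    [AddCommGroup B] [Module ℂ B] [FiniteDimensional ℂ B] (x : A →ₗ[ℂ] B) (y : B →ₗ[ℂ] A) (x' : A →ₗ[ℂ] B)
    (y' : B →ₗ[ℂ] A) :
    LinearMap.trace ℂ B (x ∘ₗ y ∘ₗ x' ∘ₗ y') = LinearMap.trace ℂ B (x' ∘ₗ y' ∘ₗ x ∘ₗ y) := by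
  rw [← LinearMap.comp_assoc (x' ∘ₗ y') y x, LinearMap.trace_comp_comm', LinearMap.comp_assoc]

/-- **The rank identity.** Let `M`, `F` be finite-dimensional complex vector spaces and `bⱼ : M → F`,
`cⱼ : F → M` (`j < r`) linear maps with the (normalised) TRIPLE RELATIONS
`bⱼ cⱼ b_k + b_k cⱼ bⱼ = (1 + [j = k]) b_k`, and suppose `Σⱼ cⱼ bⱼ = γ · 1_M`, `Σⱼ bⱼ cⱼ = ν · 1_F`. If some
`c_{j₀} b_{j₀} ≠ 0` and `b_{j₀}(M)` lies in a subspace of `F` of dimension `< r`, then there is an integer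
`1 ≤ ρ < r` with `dim M · (r + 1 − ρ) = r ρ`. PROOF: `Eⱼ = cⱼ bⱼ` and `E′ⱼ = bⱼ cⱼ` are idempotents of equal
trace `ρⱼ = rk Eⱼ`; the relation for `j ≠ k`, composed with `c_k` and traced, gives
`tr(E′ⱼ E′_k) + tr(E_k Eⱼ) = ρ_k`, whose left side is symmetric in `j, k` — so all `ρⱼ` are equal (`= ρ`); summing
the relations over `j` gives `ν b_k + b_k γ = (r+1) b_k`, so `γ + ν = r + 1`; traces give `γ · dim M = r ρ = ν r`.
[cite: HoffmanKunze1971LinearAlgebra, §6.7 (projections: trace of an idempotent is the dimension of its range) and §8.2]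
[cite: Ribet1983, Thm. 3 (the Lie step at maximal raising rank `dim P − 1`, classification-free replacement)] -/
theorem UnitaryTriple.rank_identity {M F : Type*} [AddCommGroup M] [Module ℂ M] [FiniteDimensional ℂ M]
    [AddCommGroup F] [Module ℂ F] [FiniteDimensional ℂ F] {r : ℕ}
    (b : Fin r → M →ₗ[ℂ] F) (c : Fin r → F →ₗ[ℂ] M)
    (hrel : ∀ j k, b j ∘ₗ c j ∘ₗ b k + b k ∘ₗ c j ∘ₗ b j = if j = k then (2 : ℂ) • b k else b k)
    {γ ν : ℂ} (hG : ∑ j, c j ∘ₗ b j = γ • LinearMap.id) (hN : ∑ j, b j ∘ₗ c j = ν • LinearMap.id)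
    (hF : Module.finrank ℂ F = r) (j₀ : Fin r) (hE0 : c j₀ ∘ₗ b j₀ ≠ 0) (H : Submodule ℂ F)
    (hH : LinearMap.range (b j₀) ≤ H) (hHr : Module.finrank ℂ H < r) :
    ∃ ρ : ℕ, 1 ≤ ρ ∧ ρ < r ∧ Module.finrank ℂ M * (r + 1 - ρ) = r * ρ := by
  classical
  -- the partial-isometry relation `b c b = b`
  have hbcb : ∀ j, b j ∘ₗ c j ∘ₗ b j = b j := fun j => by
    have h := hrel j j
    rw [if_pos rfl, ← two_smul ℂ] at h
    exact smul_right_injective _ (two_ne_zero' ℂ) h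
  -- the idempotents `E j = c j b j` on `M` and `E' j = b j c j` on `F`
  have hE : ∀ j, IsIdempotentElem (c j ∘ₗ b j) := fun j => by
    change (c j ∘ₗ b j) * (c j ∘ₗ b j) = c j ∘ₗ b j
    rw [Module.End.mul_eq_comp, LinearMap.comp_assoc, hbcb]
  have hE' : ∀ j, IsIdempotentElem (b j ∘ₗ c j) := fun j => by
    change (b j ∘ₗ c j) * (b j ∘ₗ c j) = b j ∘ₗ c j
    rw [Module.End.mul_eq_comp, LinearMap.comp_assoc, ← LinearMap.comp_assoc (c j) (b j) (c j),
      ← LinearMap.comp_assoc (c j) (c j ∘ₗ b j) (b j), hbcb]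
  have htrE : ∀ j, LinearMap.trace ℂ M (c j ∘ₗ b j) = (Module.finrank ℂ (LinearMap.range (c j ∘ₗ b j)) : ℂ) :=
    fun j => LinearMap.IsProj.trace (LinearMap.IsIdempotentElem.isProj_range _ (hE j))
  have htrE' : ∀ j, LinearMap.trace ℂ F (b j ∘ₗ c j) = (Module.finrank ℂ (LinearMap.range (b j ∘ₗ c j)) : ℂ) :=
    fun j => LinearMap.IsProj.trace (LinearMap.IsIdempotentElem.isProj_range _ (hE' j))
  have htrEE' : ∀ j, LinearMap.trace ℂ M (c j ∘ₗ b j) = LinearMap.trace ℂ F (b j ∘ₗ c j) := fun j =>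
    LinearMap.trace_comp_comm' _ _
  -- all ranks are equal
  set ρf : Fin r → ℕ := fun j => Module.finrank ℂ (LinearMap.range (c j ∘ₗ b j)) with hρfdef
  have hρeq : ∀ p q, ρf p = ρf q := by
    intro p q
    by_cases hpq : p = q
    · rw [hpq]
    have key : ∀ p q, p ≠ q → (ρf p : ℂ) = LinearMap.trace ℂ F (b q ∘ₗ c q ∘ₗ b p ∘ₗ c p) +
        LinearMap.trace ℂ M (c p ∘ₗ b p ∘ₗ c q ∘ₗ b q) := by
      intro p q hpq
      have h := hrel q p
      rw [if_neg (Ne.symm hpq)] at h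
      have h2 := congrArg (fun f => c p ∘ₗ f) h
      simp only [LinearMap.comp_add] at h2
      have h3 := congrArg (LinearMap.trace ℂ M) h2
      rw [map_add, htrE p, LinearMap.trace_comp_comm' (b q ∘ₗ c q ∘ₗ b p) (c p)] at h3
      simp only [LinearMap.comp_assoc] at h3
      exact h3.symm
    have h1 := key p q hpq
    have h2 := key q p (Ne.symm hpq)
    rw [UnitaryTriple.trace_cycl (b p) (c p) (b q) (c q), UnitaryTriple.trace_cycl (c q) (b q) (c p) (b p)] at h2
    exact_mod_cast h1.trans h2.symm
  -- `γ + ν = r + 1` from the summed relations at `k = j₀`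
  have hγν : γ + ν = (r : ℂ) + 1 := by
    have hb0 : b j₀ ≠ 0 := fun h0 => hE0 (by rw [h0, LinearMap.comp_zero])
    obtain ⟨x, hx⟩ : ∃ x, b j₀ x ≠ 0 := by
      by_contra h
      push Not at h
      exact hb0 (LinearMap.ext h)
    have h1 : ∀ j, b j (c j (b j₀ x)) + b j₀ (c j (b j x)) = b j₀ x + if j = j₀ then b j₀ x else 0 := fun j => by
      have h := congrArg (fun f => f x) (hrel j j₀)
      simp only [LinearMap.add_apply, LinearMap.comp_apply] at h
      rw [h]
      split_ifs
      · rw [LinearMap.smul_apply, two_smul]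
      · rw [add_zero]
    have h2 : ∑ j, (b j (c j (b j₀ x)) + b j₀ (c j (b j x))) = ((r : ℂ) + 1) • b j₀ x := by
      rw [Finset.sum_congr rfl fun j _ => h1 j, Finset.sum_add_distrib, Finset.sum_const, Finset.card_univ,
        Fintype.card_fin, Finset.sum_ite_eq' Finset.univ j₀, if_pos (Finset.mem_univ _), add_smul, one_smul,
        ← Nat.cast_smul_eq_nsmul ℂ]
    have h3 : ∑ j, (b j (c j (b j₀ x)) + b j₀ (c j (b j x))) = (ν + γ) • b j₀ x := by
      have e1 : ∑ j, b j (c j (b j₀ x)) = (∑ j, b j ∘ₗ c j) (b j₀ x) := by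
        simp only [LinearMap.sum_apply, LinearMap.comp_apply]
      have e2 : ∑ j, b j₀ (c j (b j x)) = b j₀ ((∑ j, c j ∘ₗ b j) x) := by
        simp only [LinearMap.sum_apply, LinearMap.comp_apply, map_sum]
      rw [Finset.sum_add_distrib, e1, e2, hG, hN, LinearMap.smul_apply, LinearMap.smul_apply, LinearMap.id_apply,
        LinearMap.id_apply, map_smul, add_smul]
    rw [h3] at h2
    have h4 := sub_eq_zero.2 h2
    rw [← sub_smul, smul_eq_zero] at h4
    rcases h4 with h4 | h4
    · rw [sub_eq_zero, add_comm] at h4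
      exact h4
    · exact absurd h4 hx
  -- traces
  have htrG : γ * (Module.finrank ℂ M : ℂ) = r * (ρf j₀ : ℂ) := by
    have h := congrArg (LinearMap.trace ℂ M) hG
    rw [map_sum, map_smul, LinearMap.trace_id, smul_eq_mul] at h
    rw [← h, Finset.sum_congr rfl fun j _ => (htrE j).trans (by rw [show ρf j = ρf j₀ from hρeq j j₀] : (ρf j : ℂ) = ρf j₀),
      Finset.sum_const, Finset.card_univ, Fintype.card_fin, nsmul_eq_mul]
  have htrN : ν * (Module.finrank ℂ F : ℂ) = r * (ρf j₀ : ℂ) := by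
    have h := congrArg (LinearMap.trace ℂ F) hN
    rw [map_sum, map_smul, LinearMap.trace_id, smul_eq_mul] at h
    rw [← h, Finset.sum_congr rfl fun j _ => ((htrEE' j).symm.trans (htrE j)).trans
      (by rw [show ρf j = ρf j₀ from hρeq j j₀] : (ρf j : ℂ) = ρf j₀),
      Finset.sum_const, Finset.card_univ, Fintype.card_fin, nsmul_eq_mul]
  -- conclusion
  have hr0 : (r : ℂ) ≠ 0 := by exact_mod_cast (Fin.pos j₀).ne'
  have hνρ : ν = (ρf j₀ : ℂ) := by
    rw [hF, mul_comm] at htrN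
    exact mul_left_cancel₀ hr0 htrN
  have hγ : γ = (r : ℂ) + 1 - ρf j₀ := by rw [hνρ] at hγν; linear_combination hγν
  have hmain : (Module.finrank ℂ M : ℂ) * ((r : ℂ) + 1 - ρf j₀) = r * (ρf j₀ : ℂ) := by
    rw [hγ] at htrG; linear_combination htrG
  have hρ1 : 1 ≤ ρf j₀ := by
    by_contra hlt
    have h0 : ρf j₀ = 0 := by omega
    have hbot : LinearMap.range (c j₀ ∘ₗ b j₀) = ⊥ := Submodule.finrank_eq_zero.1 h0
    exact hE0 (LinearMap.range_eq_bot.1 hbot)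
  have hρr : ρf j₀ < r := by
    have h1 : (ρf j₀ : ℂ) = (Module.finrank ℂ (LinearMap.range (b j₀ ∘ₗ c j₀)) : ℂ) := by
      rw [← htrE' j₀, ← htrEE' j₀, htrE j₀]
    have h2 : ρf j₀ = Module.finrank ℂ (LinearMap.range (b j₀ ∘ₗ c j₀)) := by exact_mod_cast h1
    have h3 : Module.finrank ℂ (LinearMap.range (b j₀ ∘ₗ c j₀)) ≤ Module.finrank ℂ H :=
      Submodule.finrank_mono ((LinearMap.range_comp_le_range _ _).trans hH)
    omega
  refine ⟨ρf j₀, hρ1, hρr, ?_⟩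
  have hcast : ((r + 1 - ρf j₀ : ℕ) : ℂ) = (r : ℂ) + 1 - ρf j₀ := by
    rw [Nat.cast_sub (by omega)]; push_cast; ring
  have h : ((Module.finrank ℂ M * (r + 1 - ρf j₀) : ℕ) : ℂ) = ((r * ρf j₀ : ℕ) : ℂ) := by
    push_cast [Nat.cast_sub (show ρf j₀ ≤ r + 1 by omega)]
    linear_combination hmain
  exact_mod_cast h


/-! ### §3 The raising-rank lemma at `dim P = r + 1` (triple route) -/

/-- **The raising-rank lemma at `dim P = r + 1`, triple route.** Setting of the unitary cores, with the Hermitian form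
`s` moreover `ℂ`-homogeneous in the first slot; `B ∈ 𝔊` raising of rank `r ≥ 2`, `dim P = r + 1`, `dim Q = r + m`
with `m ≥ 1`. If NO integer `1 ≤ ρ < r` satisfies `m (r + 1 − ρ) = r ρ`, then some raising operator of `𝔊` has rank
`> r`. PROOF (module docstring): at maximal rank `r`, the Levi instance on `P₀ ⊕ Q₁` (type `(1 | r)`, solved by the
`(m,1)` core) produces for every `u ∈ Q₁` a raising `B_u ∈ 𝔊` with `B_u|_{Q₁} = s(·,u) η`; the double commutators
`[[B_u, B_w†], B_v]` give the TRIPLE RELATIONS `B_u B_w† B_v + B_v B_w† B_u = σ s(w,u) B_v + σ s(w,v) B_u` on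
`Q₀` (`σ = s(η,η)`); the operators `G = Σ κⱼ B_{uⱼ}† B_{uⱼ}` on `Q₀` and `N = Σ κⱼ B_{uⱼ} B_{uⱼ}†` on `P₁`
(`uⱼ` an `s`-orthogonal basis of `Q₁`, `κⱼ = (σ s(uⱼ,uⱼ))⁻¹`) are scalars `γ`, `ν` with `γ + ν = r + 1` (an
eigenvector argument using the skew relation (♣) and the covering lemma), and `UnitaryTriple.rank_identity` gives
`m (r + 1 − ρ) = r ρ` for the common rank `ρ` of the idempotents `κⱼ B_{uⱼ}† B_{uⱼ}`.
[cite: Ribet1983, Thm. 3] [cite: Deligne1982HodgeCycles, I §3 Prop. 3.6] [cite: GoodmanWallachGTM255, §4.1.1]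
[cite: HoffmanKunze1971LinearAlgebra, §8.2 Thm. 3] -/
theorem UnitaryRaisingRank.exists_raise_rank_gt_of_finrank_eq_succ_of_smul [FiniteDimensional ℂ W]
    {𝔊 : Submodule ℂ (Module.End ℂ W)}
    (hbr : ∀ Y ∈ 𝔊, ∀ Z ∈ 𝔊, Y * Z - Z * Y ∈ 𝔊)
    (hirr : ∀ U : Submodule ℂ W, (∀ A ∈ 𝔊, ∀ u ∈ U, A u ∈ U) → U = ⊥ ∨ U = ⊤)
    {Θ : Module.End ℂ W} (hΘ : Θ ∈ 𝔊) (hΘΘ : Θ * Θ = 1)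
    {P Q : Submodule ℂ W} (hP : ∀ x, x ∈ P ↔ Θ x = x) (hQ : ∀ x, x ∈ Q ↔ Θ x = -x)
    {B : Module.End ℂ W} (hB : B ∈ 𝔊) (hΘB : Θ * B = B) (hBΘ : B * Θ = -B)
    (hr2 : 2 ≤ Module.finrank ℂ (LinearMap.range B))
    (hrP : Module.finrank ℂ P = Module.finrank ℂ (LinearMap.range B) + 1)
    (hrQ : Module.finrank ℂ (LinearMap.range B) < Module.finrank ℂ Q)
    (hno : ∀ ρ : ℕ, 1 ≤ ρ → ρ < Module.finrank ℂ (LinearMap.range B) →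
      (Module.finrank ℂ Q - Module.finrank ℂ (LinearMap.range B)) * (Module.finrank ℂ (LinearMap.range B) + 1 - ρ) ≠
        Module.finrank ℂ (LinearMap.range B) * ρ)
    {s : W → W → ℂ} (hadd : ∀ x y z, s (x + y) z = s x z + s y z)
    (hsmul : ∀ (c : ℂ) (x y : W), s (c • x) y = c * s x y) (hsymm : ∀ x y, s y x = starRingEnd ℂ (s x y))
    (hPQ : ∀ p ∈ P, ∀ q ∈ Q, s p q = 0) (hdefP : ∀ p ∈ P, s p p = 0 → p = 0) (hdefQ : ∀ q ∈ Q, s q q = 0 → q = 0)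
    (hadj : ∀ X ∈ 𝔊, ∃ Y ∈ 𝔊, ∀ x y, s (X x) y = s x (Y y)) :
    ∃ B' ∈ 𝔊, Θ * B' = B' ∧ B' * Θ = -B' ∧
      Module.finrank ℂ (LinearMap.range B) < Module.finrank ℂ (LinearMap.range B') := by
  classical
  obtain ⟨haddr, h0r, h0l, hnegr, hnegl, hsubr, hsubl⟩ := UnitaryTwoOdd.herm_right hadd hsymm
  have hsmulr := UnitaryTriple.smul_right hsmul hsymm
  have hΘΘv : ∀ v, Θ (Θ v) = v := fun v => by rw [← Module.End.mul_apply, hΘΘ, Module.End.one_apply]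
  have hPhat : ∀ w, (2 : ℂ)⁻¹ • (w + Θ w) ∈ P := fun w => (hP _).2 (by rw [map_smul, map_add, hΘΘv, add_comm])
  have hQhat : ∀ w, (2 : ℂ)⁻¹ • (w - Θ w) ∈ Q := fun w =>
    (hQ _).2 (by rw [map_smul, map_sub, hΘΘv, ← smul_neg, neg_sub])
  have hsplit : ∀ w, (2 : ℂ)⁻¹ • (w + Θ w) + (2 : ℂ)⁻¹ • (w - Θ w) = w := fun w => by module
  have hP0 : ∃ p : W, p ≠ 0 ∧ Θ p = p := by
    obtain ⟨⟨p, hp⟩, hp0⟩ := Module.finrank_pos_iff_exists_ne_zero.1 (show 0 < Module.finrank ℂ P by omega)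
    exact ⟨p, fun h => hp0 (Subtype.ext h), (hP p).1 hp⟩
  have hraiseval : ∀ Z : Module.End ℂ W, Θ * Z = Z → ∀ w, Z w ∈ P := fun Z hΘZ w =>
    (hP _).2 (by rw [← Module.End.mul_apply, hΘZ])
  have hraiseP : ∀ Z : Module.End ℂ W, Z * Θ = -Z → ∀ p ∈ P, Z p = 0 := fun Z hZΘ p hp => by
    have h : Z p = -(Z p) := by
      conv_lhs => rw [← (hP p).1 hp]
      rw [← Module.End.mul_apply, hZΘ, LinearMap.neg_apply]
    have h2 : (2 : ℂ) • Z p = 0 := by rw [two_smul]; nth_rewrite 2 [h]; rw [add_neg_cancel]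
    exact (smul_eq_zero.1 h2).resolve_left two_ne_zero
  have hlowerQ : ∀ Z : Module.End ℂ W, Z * Θ = Z → ∀ q ∈ Q, Z q = 0 := fun Z hZΘ q hq => by
    have h : Z q = -(Z q) := by
      conv_lhs => rw [← neg_neg q, ← (hQ q).1 hq, map_neg, ← Module.End.mul_apply, hZΘ]
    have h2 : (2 : ℂ) • Z q = 0 := by rw [two_smul]; nth_rewrite 2 [h]; rw [add_neg_cancel]
    exact (smul_eq_zero.1 h2).resolve_left two_ne_zero
  have hlowerval : ∀ Z : Module.End ℂ W, Θ * Z = -Z → ∀ w, Z w ∈ Q := fun Z hΘZ w =>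
    (hQ _).2 (by rw [← Module.End.mul_apply, hΘZ, LinearMap.neg_apply])
  have hΘs := UnitaryTwoOdd.theta_selfAdjoint hadd hsymm hΘΘ hP hQ hPQ
  by_contra hcon
  push Not at hcon
  have hmax : ∀ B' ∈ 𝔊, Θ * B' = B' → B' * Θ = -B' →
      Module.finrank ℂ (LinearMap.range B') ≤ Module.finrank ℂ (LinearMap.range B) := hcon
  -- STEP 1: `B`, its adjoint `C` and the projector pair `D`
  have hBmem : ∀ w, B w ∈ P := hraiseval B hΘB
  have hBP : ∀ p ∈ P, B p = 0 := hraiseP B hBΘ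
  have hrangeP : LinearMap.range B ≤ P := by rintro _ ⟨w, rfl⟩; exact hBmem w
  obtain ⟨C, hC, hBC⟩ := hadj B hB
  obtain ⟨hΘC, hCΘ⟩ := UnitaryTwoOdd.lower_of_adjoint hadd hsymm hΘΘ hP hQ hPQ hdefP hdefQ hΘB hBΘ hBC
  have hCmem : ∀ w, C w ∈ Q := hlowerval C hΘC
  have hCQ : ∀ q ∈ Q, C q = 0 := hlowerQ C hCΘ
  obtain ⟨D, hD, hDΘ, hD1, hD2, hD3, hD4, hD5, hD6, hpos1, hpos2, hdec, hDs⟩ :=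
    UnitaryThreeCoprime.exists_projector_pair hbr hΘΘ hP hQ hadd hsymm hPQ hdefP hdefQ hB hC hΘB hBΘ hBC
  have hDP : ∀ p ∈ P, D p ∈ P := fun p hp => hrangeP (hD5 p hp).1
  have hDfix : ∀ x ∈ LinearMap.range B, D x = x := by rintro _ ⟨w, rfl⟩; exact hD1 w
  have hDDP : ∀ p ∈ P, D (D p) = D p := fun p hp => hDfix _ (hD5 p hp).1
  have hkerD : ∀ p ∈ P, D p = 0 → C p = 0 := fun p hp h => by
    have h' := (hD5 p hp).2; rwa [h, sub_zero] at h'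
  have hCinjR : ∀ x ∈ LinearMap.range B, C x = 0 → x = 0 := by rintro _ ⟨w, rfl⟩ h; exact hpos2 w h
  have hCD : ∀ p ∈ P, C p = C (D p) := fun p hp => by
    have h := (hD5 p hp).2; rw [map_sub, sub_eq_zero] at h; exact h
  -- STEP 2 (★): every raising operator maps `Q₀ = Q ∩ ker B` into `P₁ = B(W)`
  have hcommbr : ∀ X : Module.End ℂ W, Θ * X = X → X * Θ = -X →
      Θ * (D * X - X * D) = D * X - X * D ∧ (D * X - X * D) * Θ = -(D * X - X * D) := fun X h1 h2 =>
    ⟨by rw [mul_sub, ← mul_assoc, ← hDΘ, mul_assoc, h1, ← mul_assoc, h1],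
     by rw [sub_mul, mul_assoc, h2, mul_assoc, hDΘ, ← mul_assoc, h2, mul_neg, neg_mul, neg_sub_neg, neg_sub]⟩
  have hstar : ∀ B' ∈ 𝔊, Θ * B' = B' → B' * Θ = -B' → ∀ q ∈ Q, B q = 0 → D (B' q) = B' q := by
    intro B' hB' hΘB' hB'Θ
    by_contra hne
    push Not at hne
    obtain ⟨q₀, hq₀Q, hBq₀, hneq⟩ := hne
    have hB'P : ∀ p ∈ P, B' p = 0 := hraiseP B' hB'Θ
    have hB'mem : ∀ w, B' w ∈ P := hraiseval B' hΘB'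
    set N : Module.End ℂ W := D * B' - B' * D with hNdef
    obtain ⟨hΘN, hNΘ⟩ : Θ * N = N ∧ N * Θ = -N := hcommbr B' hΘB' hB'Θ
    set N₂ : Module.End ℂ W := D * N - N * D with hN₂def
    obtain ⟨hΘN₂, hN₂Θ⟩ : Θ * N₂ = N₂ ∧ N₂ * Θ = -N₂ := hcommbr N hΘN hNΘ
    have hNmem : N ∈ 𝔊 := hbr D hD B' hB'
    have hN₂mem : N₂ ∈ 𝔊 := hbr D hD N hNmem
    set B₀ : Module.End ℂ W := (2 : ℂ)⁻¹ • (N₂ - (3 : ℂ) • N + (2 : ℂ) • B') with hB₀def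
    have hB₀mem : B₀ ∈ 𝔊 := Submodule.smul_mem _ _ (Submodule.add_mem _ (Submodule.sub_mem _ hN₂mem
      (Submodule.smul_mem _ _ hNmem)) (Submodule.smul_mem _ _ hB'))
    have hΘB₀ : Θ * B₀ = B₀ := by
      rw [hB₀def, mul_smul_comm, mul_add, mul_sub, mul_smul_comm, mul_smul_comm, hΘN₂, hΘN, hΘB']
    have hB₀Θ : B₀ * Θ = -B₀ := by
      rw [hB₀def, smul_mul_assoc, add_mul, sub_mul, smul_mul_assoc, smul_mul_assoc, hN₂Θ, hNΘ, hB'Θ]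
      module
    have hNq : ∀ q ∈ Q, B q = 0 → N q = D (B' q) := fun q hq hBq => by
      rw [hNdef, LinearMap.sub_apply, Module.End.mul_apply, Module.End.mul_apply, hD4 q hq hBq, map_zero, sub_zero]
    have hNP : ∀ p ∈ P, N p = 0 := fun p hp => by
      rw [hNdef, LinearMap.sub_apply, Module.End.mul_apply, Module.End.mul_apply, hB'P p hp, map_zero,
        hB'P _ (hDP p hp), sub_zero]
    have hNC : ∀ p ∈ P, N (C p) = D (B' (C p)) + B' (C p) := fun p hp => by
      rw [hNdef, LinearMap.sub_apply, Module.End.mul_apply, Module.End.mul_apply, hD3 p hp, map_neg, sub_neg_eq_add]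
    have hN₂q : ∀ q ∈ Q, B q = 0 → N₂ q = D (B' q) := fun q hq hBq => by
      rw [hN₂def, LinearMap.sub_apply, Module.End.mul_apply, Module.End.mul_apply, hNq q hq hBq, hD4 q hq hBq,
        map_zero, sub_zero, hDDP _ (hB'mem q)]
    have hN₂C : ∀ p ∈ P, N₂ (C p) = D (B' (C p)) + D (B' (C p)) + (D (B' (C p)) + B' (C p)) := fun p hp => by
      rw [hN₂def, LinearMap.sub_apply, Module.End.mul_apply, Module.End.mul_apply, hNC p hp, hD3 p hp, map_neg,
        hNC p hp, map_add, hDDP _ (hB'mem _), sub_neg_eq_add]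
    have hB₀q : ∀ q ∈ Q, B q = 0 → B₀ q = B' q - D (B' q) := fun q hq hBq => by
      rw [hB₀def, LinearMap.smul_apply, LinearMap.add_apply, LinearMap.sub_apply, LinearMap.smul_apply,
        LinearMap.smul_apply, hN₂q q hq hBq, hNq q hq hBq]
      module
    have hB₀C : ∀ p ∈ P, B₀ (C p) = 0 := fun p hp => by
      rw [hB₀def, LinearMap.smul_apply, LinearMap.add_apply, LinearMap.sub_apply, LinearMap.smul_apply,
        LinearMap.smul_apply, hN₂C p hp, hNC p hp]
      module
    have hsum_mem : B + B₀ ∈ 𝔊 := Submodule.add_mem _ hB hB₀mem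
    have hΘsum : Θ * (B + B₀) = B + B₀ := by rw [mul_add, hΘB, hΘB₀]
    have hsumΘ : (B + B₀) * Θ = -(B + B₀) := by rw [add_mul, hBΘ, hB₀Θ, neg_add]
    set x₀ := B' q₀ - D (B' q₀) with hx₀def
    have hx₀0 : x₀ ≠ 0 := fun h => hneq (by rw [hx₀def, sub_eq_zero] at h; exact h.symm)
    have hx₀nr : x₀ ∉ LinearMap.range B := fun h => by
      have h1 := hDfix x₀ h
      rw [hx₀def, map_sub, hDDP _ (hB'mem q₀), sub_self] at h1
      exact hx₀0 h1.symm
    have hx₀val : (B + B₀) q₀ = x₀ := by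
      rw [LinearMap.add_apply, hBq₀, zero_add, hB₀q q₀ hq₀Q hBq₀]
    have hrange1 : LinearMap.range B ≤ LinearMap.range (B + B₀) := by
      rintro _ ⟨w, rfl⟩
      set q := (2 : ℂ)⁻¹ • (w - Θ w) with hqdef
      obtain ⟨hDq, hBq⟩ := hD6 q (hQhat w)
      obtain ⟨p', hp', hp'q⟩ := hDq
      refine ⟨-(D q), ?_⟩
      have hBw : B w = B q := by
        conv_lhs => rw [← hsplit w, map_add, hBP _ (hPhat w), zero_add]
      rw [LinearMap.add_apply, map_neg, map_neg, ← hp'q, hB₀C p' hp', neg_zero, add_zero, hp'q, hBw]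
      rw [map_add] at hBq
      rw [← neg_eq_of_add_eq_zero_right hBq, neg_neg]
    have hrange2 : LinearMap.range B ⊔ (ℂ ∙ x₀) ≤ LinearMap.range (B + B₀) :=
      sup_le hrange1 ((Submodule.span_singleton_le_iff_mem _ _).2 ⟨q₀, hx₀val⟩)
    have hinf : LinearMap.range B ⊓ (ℂ ∙ x₀) = ⊥ := by
      rw [eq_bot_iff]
      rintro y ⟨hy1, hy2⟩
      rw [Submodule.mem_bot]
      obtain ⟨c, rfl⟩ := Submodule.mem_span_singleton.1 hy2
      by_cases hc : c = 0
      · rw [hc, zero_smul]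
      · exact absurd (by
          have := Submodule.smul_mem _ c⁻¹ hy1
          rwa [smul_smul, inv_mul_cancel₀ hc, one_smul] at this) hx₀nr
    have hfin : Module.finrank ℂ ↥(LinearMap.range B ⊔ (ℂ ∙ x₀)) = Module.finrank ℂ (LinearMap.range B) + 1 := by
      have h := Submodule.finrank_sup_add_finrank_inf_eq (LinearMap.range B) (ℂ ∙ x₀)
      rw [hinf, finrank_bot, add_zero, finrank_span_singleton hx₀0] at h
      exact h
    have hmono := Submodule.finrank_mono hrange2
    have hle' := hmax (B + B₀) hsum_mem hΘsum hsumΘ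
    rw [hfin] at hmono
    omega
  have hstar' : ∀ B' ∈ 𝔊, Θ * B' = B' → B' * Θ = -B' → ∀ q ∈ Q, B q = 0 → B' q ∈ LinearMap.range B :=
    fun B' hB' h1 h2 q hq hBq => hstar B' hB' h1 h2 q hq hBq ▸ (hD5 _ (hraiseval B' h1 q)).1
  -- STEP 3 (♣)
  have hclub : ∀ B' ∈ 𝔊, Θ * B' = B' → B' * Θ = -B' → ∀ B'' ∈ 𝔊, Θ * B'' = B'' → B'' * Θ = -B'' →
      ∀ q ∈ Q, B q = 0 → D (B' (C (B'' q)) + B'' (C (B' q))) = B' (C (B'' q)) + B'' (C (B' q)) := by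
    intro B' hB' hΘB' hB'Θ B'' hB'' hΘB'' hB''Θ q hq hBq
    set M : Module.End ℂ W := B' * C - C * B' with hMdef
    have hMmem : M ∈ 𝔊 := hbr B' hB' C hC
    have hMΘ : M * Θ = Θ * M := by
      rw [hMdef, sub_mul, mul_sub, mul_assoc, hCΘ, mul_assoc, hB'Θ, ← mul_assoc, hΘB', ← mul_assoc, hΘC, mul_neg,
        neg_mul]
    set R : Module.End ℂ W := M * B'' - B'' * M with hRdef
    have hRmem : R ∈ 𝔊 := hbr M hMmem B'' hB''
    have hΘR : Θ * R = R := by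
      rw [hRdef, mul_sub, ← mul_assoc, ← hMΘ, mul_assoc, hΘB'', ← mul_assoc, hΘB'']
    have hRΘ : R * Θ = -R := by
      rw [hRdef, sub_mul, mul_assoc, hB''Θ, mul_assoc, hMΘ, ← mul_assoc, hB''Θ, mul_neg, neg_mul, neg_sub_neg, neg_sub]
    have h := hstar R hRmem hΘR hRΘ q hq hBq
    have hRq : R q = B' (C (B'' q)) + B'' (C (B' q)) := by
      rw [hRdef, LinearMap.sub_apply, Module.End.mul_apply, Module.End.mul_apply, hMdef, LinearMap.sub_apply,
        LinearMap.sub_apply, Module.End.mul_apply, Module.End.mul_apply, Module.End.mul_apply, Module.End.mul_apply,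
        hraiseP B' hB'Θ _ (hraiseval B'' hΘB'' q), map_zero, sub_zero, hCQ q hq, map_zero, zero_sub, map_neg,
        sub_neg_eq_add]
    rwa [hRq] at h
  -- STEP 4: `P₀ = ℂη`, the dimensions of `Q₁ = C(P)` and `Q₀ = Q ∩ ker B`
  have hfinP₀ : Module.finrank ℂ ↥(P ⊓ LinearMap.ker C) = 1 := by
    have hsup : (P ⊓ LinearMap.ker C) ⊔ LinearMap.range B = P := by
      apply le_antisymm (sup_le inf_le_left hrangeP)
      intro p hp
      obtain ⟨hDp, hCp⟩ := hD5 p hp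
      have h : p = (p - D p) + D p := by abel
      rw [h]
      exact Submodule.add_mem _ (Submodule.mem_sup_left (Submodule.mem_inf.2
        ⟨Submodule.sub_mem _ hp (hrangeP hDp), LinearMap.mem_ker.2 hCp⟩)) (Submodule.mem_sup_right hDp)
    have hinf : (P ⊓ LinearMap.ker C) ⊓ LinearMap.range B = ⊥ := by
      rw [eq_bot_iff]
      rintro x ⟨⟨-, hxC⟩, hxr⟩
      rw [Submodule.mem_bot]
      exact hCinjR x hxr (LinearMap.mem_ker.1 hxC)
    have h := Submodule.finrank_sup_add_finrank_inf_eq (P ⊓ LinearMap.ker C) (LinearMap.range B)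
    rw [hsup, hinf, finrank_bot, add_zero, hrP] at h
    omega
  obtain ⟨⟨η, hηmem⟩, hη0⟩ := Module.finrank_pos_iff_exists_ne_zero.1
    (show 0 < Module.finrank ℂ ↥(P ⊓ LinearMap.ker C) by omega)
  have hη0' : η ≠ 0 := fun h => hη0 (Subtype.ext h)
  obtain ⟨hηP, hηC⟩ := Submodule.mem_inf.1 hηmem
  have hCη : C η = 0 := LinearMap.mem_ker.1 hηC
  have hDη : D η = 0 := hD2 η hηP hCη
  have hΘη : Θ η = η := (hP η).1 hηP
  set gC : ↥(LinearMap.range B) →ₗ[ℂ] W := C ∘ₗ (LinearMap.range B).subtype with hgCdef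
  have hgCapply : ∀ x : LinearMap.range B, gC x = C x := fun x => rfl
  have hgCinj : Function.Injective gC := by
    intro x y hxy
    apply Subtype.ext
    have h : C ((x : W) - y) = 0 := by rw [map_sub, sub_eq_zero]; exact hxy
    exact sub_eq_zero.1 (hCinjR _ (Submodule.sub_mem _ x.2 y.2) h)
  have hmapC : P.map C = LinearMap.range gC := by
    apply le_antisymm
    · rintro _ ⟨p, hp, rfl⟩
      exact ⟨⟨D p, (hD5 p hp).1⟩, by rw [hgCapply, ← hCD p hp]⟩
    · rintro _ ⟨x, rfl⟩
      exact ⟨x, hrangeP x.2, rfl⟩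
  have hfinQU : Module.finrank ℂ ↥(P.map C) = Module.finrank ℂ (LinearMap.range B) := by
    rw [hmapC, LinearMap.finrank_range_of_inj hgCinj]
  have hfinQ₀ : Module.finrank ℂ ↥(Q ⊓ LinearMap.ker B) + Module.finrank ℂ (LinearMap.range B) =
      Module.finrank ℂ Q := by
    have hsup : (Q ⊓ LinearMap.ker B) ⊔ P.map C = Q := by
      apply le_antisymm (sup_le inf_le_left (by rintro _ ⟨p, hp, rfl⟩; exact hCmem p))
      intro q hq
      obtain ⟨hDq, hBq⟩ := hD6 q hq
      have h : q = (q + D q) + (-(D q)) := by abel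
      rw [h]
      refine Submodule.add_mem _ (Submodule.mem_sup_left (Submodule.mem_inf.2 ⟨Submodule.add_mem _ hq ?_,
        LinearMap.mem_ker.2 hBq⟩)) (Submodule.mem_sup_right (Submodule.neg_mem _ hDq))
      obtain ⟨p, hp, hpq⟩ := hDq
      rw [← hpq]; exact hCmem p
    have hinf : (Q ⊓ LinearMap.ker B) ⊓ P.map C = ⊥ := by
      rw [eq_bot_iff]
      rintro x ⟨⟨-, hxB⟩, ⟨p, hp, rfl⟩⟩
      rw [Submodule.mem_bot]
      exact hpos1 p hp (LinearMap.mem_ker.1 hxB)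
    have h := Submodule.finrank_sup_add_finrank_inf_eq (Q ⊓ LinearMap.ker B) (P.map C)
    rw [hsup, hinf, finrank_bot, add_zero, hfinQU] at h
    exact h.symm
  -- membership facts for `Q₁ = C(P)` and `Q₀ = Q ∩ ker B`
  have hQ₁Q : ∀ v ∈ P.map C, v ∈ Q := by rintro _ ⟨p, hp, rfl⟩; exact hCmem p
  have hCmap : ∀ w, C w ∈ P.map C := fun w => by
    refine ⟨(2 : ℂ)⁻¹ • (w + Θ w), hPhat w, ?_⟩
    conv_rhs => rw [← hsplit w]
    rw [map_add, hCQ _ (hQhat w), add_zero]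
  have hP₁η : ∀ x ∈ LinearMap.range B, s x η = 0 := by
    rintro _ ⟨w, rfl⟩; rw [hBC, hCη, h0r]
  have hQ₀Q₁ : ∀ q ∈ Q, B q = 0 → ∀ v ∈ P.map C, s q v = 0 := by
    rintro q hq hBq _ ⟨p, hp, rfl⟩; rw [← hBC, hBq, h0l]
  have hdefQU : ∀ y ∈ P.map C, s y y = 0 → y = 0 := fun y hy h => hdefQ y (hQ₁Q y hy) h
  set σ := s η η with hσdef
  have hσ0 : σ ≠ 0 := fun h => hη0' (hdefP η hηP h)
  have hσreal : starRingEnd ℂ σ = σ := by rw [hσdef, ← hsymm]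
  -- STEP 5: the involution `Θ' = 2D − Θ` and its Levi instance on `{Θ' = −1} = P₀ ⊕ Q₁`
  set Θ' : Module.End ℂ W := (2 : ℂ) • D - Θ with hΘ'def
  have hΘ'mem : Θ' ∈ 𝔊 := Submodule.sub_mem _ (Submodule.smul_mem _ _ hD) hΘ
  have hΘ'apply : ∀ w, Θ' w = D w + D w - Θ w := fun w => by
    rw [hΘ'def, LinearMap.sub_apply, LinearMap.smul_apply, two_smul]
  have hΘ'a : ∀ a ∈ LinearMap.range B, Θ' a = a := fun a ha => by
    rw [hΘ'apply, hDfix a ha, (hP a).1 (hrangeP ha)]; abel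
  have hΘ'b : ∀ b ∈ P ⊓ LinearMap.ker C, Θ' b = -b := fun b hb => by
    obtain ⟨hbP, hbC⟩ := Submodule.mem_inf.1 hb
    rw [hΘ'apply, hD2 b hbP (LinearMap.mem_ker.1 hbC), (hP b).1 hbP]; abel
  have hΘ'c : ∀ c ∈ P.map C, Θ' c = -c := fun c hc => by
    obtain ⟨p, hp, rfl⟩ := hc
    rw [hΘ'apply, hD3 p hp, (hQ _).1 (hCmem p)]; abel
  have hΘ'd : ∀ d ∈ Q ⊓ LinearMap.ker B, Θ' d = d := fun d hd => by
    obtain ⟨hdQ, hdB⟩ := Submodule.mem_inf.1 hd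
    rw [hΘ'apply, hD4 d hdQ (LinearMap.mem_ker.1 hdB), (hQ d).1 hdQ]; abel
  have hΘ'Θ' : Θ' * Θ' = 1 := by
    refine LinearMap.ext fun w => ?_
    obtain ⟨a, ha, b, hb, c, hc, d, hd, rfl⟩ := hdec w
    have h1 : Θ' (a + b + c + d) = a - b - c + d := by
      rw [map_add, map_add, map_add, hΘ'a a ha, hΘ'b b hb, hΘ'c c hc, hΘ'd d hd]; abel
    have h2 : Θ' (a - b - c + d) = a + b + c + d := by
      rw [map_add, map_sub, map_sub, hΘ'a a ha, hΘ'b b hb, hΘ'c c hc, hΘ'd d hd]; abel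
    rw [Module.End.mul_apply, Module.End.one_apply, h1, h2]
  have h12 : Θ' * Θ = Θ * Θ' := by
    rw [hΘ'def, sub_mul, mul_sub, smul_mul_assoc, mul_smul_comm, hDΘ]
  have hΘ's : ∀ x y, s (Θ' x) y = s x (Θ' y) := fun x y => by
    rw [hΘ'apply, hΘ'apply, hsubl, hadd, hsubr, haddr, hDs, hΘs]
  set U'' : Submodule ℂ W := LinearMap.ker (Θ' + 1) with hU''def
  have hU'' : ∀ x, x ∈ U'' ↔ Θ' x = -x := fun x => by
    rw [hU''def, LinearMap.mem_ker, LinearMap.add_apply, Module.End.one_apply, add_eq_zero_iff_eq_neg]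
  have hPUle : P ⊓ LinearMap.ker C ≤ U'' := fun b hb => (hU'' b).2 (hΘ'b b hb)
  have hQUle : P.map C ≤ U'' := fun c hc => (hU'' c).2 (hΘ'c c hc)
  have hPUmem : ∀ x ∈ U'', Θ x = x → x ∈ P ⊓ LinearMap.ker C := fun x hxU hΘx => by
    have hxP : x ∈ P := (hP x).2 hΘx
    have h := (hU'' x).1 hxU
    rw [hΘ'apply, hΘx, sub_eq_iff_eq_add, neg_add_cancel, ← two_smul ℂ, smul_eq_zero] at h
    exact Submodule.mem_inf.2 ⟨hxP, LinearMap.mem_ker.2 (hkerD x hxP (h.resolve_left two_ne_zero))⟩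
  have hPUΘ : ∀ x ∈ P ⊓ LinearMap.ker C, Θ x = x := fun x hx => (hP x).1 (Submodule.mem_inf.1 hx).1
  have hQUmem : ∀ x ∈ U'', Θ x = -x → x ∈ P.map C := fun x hxU hΘx => by
    have hxQ : x ∈ Q := (hQ x).2 hΘx
    have h := (hU'' x).1 hxU
    rw [hΘ'apply, hΘx, sub_neg_eq_add, ← sub_eq_zero] at h
    have h' : (2 : ℂ) • (D x + x) = 0 := by rw [two_smul, ← h]; abel
    rw [smul_eq_zero] at h'
    have hDx : D x = -x := eq_neg_of_add_eq_zero_left (h'.resolve_left two_ne_zero)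
    have := (hD6 x hxQ).1
    rw [hDx] at this
    simpa using Submodule.neg_mem _ this
  have hQUΘ : ∀ x ∈ P.map C, Θ x = -x := fun x hx => (hQ _).1 (hQ₁Q x hx)
  have hPUQU : ∀ x ∈ P ⊓ LinearMap.ker C, ∀ y ∈ P.map C, s x y = 0 := fun x hx y hy =>
    hPQ _ (Submodule.mem_inf.1 hx).1 _ (hQ₁Q y hy)
  have hdefPU : ∀ x ∈ P ⊓ LinearMap.ker C, s x x = 0 → x = 0 := fun x hx h => hdefP x (Submodule.mem_inf.1 hx).1 h
  have hLevi := UnitaryThreeCoprime.levi_instance hbr hirr hΘΘ hP hQ hadd hsymm hPQ hdefP hdefQ hadj hΘ'mem hΘ'Θ'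
    hΘ's hΘ hΘΘ h12 hU'' hPUle hQUle hPUmem hPUΘ hQUmem hQUΘ hPUQU hdefPU hdefQU
    (fun 𝔩 ι P' Q' hbr𝔩 hirr𝔩 hι hιι hP' hQ' hfinP' hfinQ' _ _ _ _ =>
      UnitaryThreeCoprime.eq_top_of_finrank_eq_one hbr𝔩 hirr𝔩 (Submodule.neg_mem _ hι)
        (UnitaryTriple.neg_mul_neg_eq_one_of hιι)
        (P := Q') (Q := P') (fun x => by rw [hQ', LinearMap.neg_apply, neg_eq_iff_eq_neg])
        (fun x => by rw [hP', LinearMap.neg_apply, neg_inj]) (by rw [hfinQ', hfinQU]; exact hr2) (by rw [hfinP', hfinP₀]))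
  -- STEP 6: the raising operators `B_u` (`u ∈ W`) with `B_u|_{Q₁} = s(·, u) η`, and their adjoints `C_u`
  set ηU : U'' := ⟨η, hPUle hηmem⟩ with hηUdef
  obtain ⟨sℓ, hsℓ⟩ : ∃ sℓ : W → (W →ₗ[ℂ] ℂ), ∀ u x, sℓ u x = s x u :=
    ⟨fun u =>
      { toFun := fun x => s x u
        map_add' := fun x y => hadd x y u
        map_smul' := fun c x => by rw [hsmul, smul_eq_mul, RingHom.id_apply] }, fun u x => rfl⟩
  have hZex : ∀ u : W, ∃ Z ∈ 𝔊, Z * Θ' = Θ' * Z ∧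
      ∀ x : U'', ((((sℓ u) ∘ₗ U''.subtype).smulRight ηU x : U'') : W) = Z x := fun u => hLevi _
  choose Z hZmem hZΘ' hZval using hZex
  have hZval' : ∀ u, ∀ x ∈ U'', Z u x = (s x u) • η := fun u x hx => by
    have h := hZval u ⟨x, hx⟩
    rw [LinearMap.smulRight_apply, LinearMap.comp_apply, Submodule.subtype_apply, Submodule.coe_smul, hsℓ] at h
    exact h.symm
  obtain ⟨Bu, hBudef⟩ : ∃ Bu : W → Module.End ℂ W,
      ∀ u, Bu u = (4 : ℂ)⁻¹ • (Z u + Θ * Z u - Z u * Θ - Θ * Z u * Θ) := ⟨_, fun u => rfl⟩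
  have hBurel : ∀ u, Bu u ∈ 𝔊 ∧ Θ * Bu u = Bu u ∧ Bu u * Θ = -(Bu u) := fun u => by
    rw [hBudef u]; exact UnitaryThetaCore.raise_relations hbr hΘ hΘΘ (hZmem u)
  have hBuval : ∀ u, ∀ v ∈ P.map C, Bu u v = (s v u) • η := fun u v hv => by
    have hvQ : Θ v = -v := hQUΘ v hv
    have hZv : Z u v = (s v u) • η := hZval' u v (hQUle hv)
    have hΘZv : Θ (Z u v) = Z u v := by rw [hZv, map_smul, hΘη]
    rw [hBudef u, LinearMap.smul_apply, LinearMap.sub_apply, LinearMap.sub_apply, LinearMap.add_apply,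
      Module.End.mul_apply, Module.End.mul_apply, Module.End.mul_apply, Module.End.mul_apply, hvQ, map_neg, map_neg,
      hΘZv, ← hZv]
    module
  have hBuP : ∀ u, ∀ p ∈ P, Bu u p = 0 := fun u => hraiseP (Bu u) (hBurel u).2.2
  have hBumem : ∀ u w, Bu u w ∈ P := fun u => hraiseval (Bu u) (hBurel u).2.1
  have hBuQ₀ : ∀ u, ∀ q ∈ Q, B q = 0 → Bu u q ∈ LinearMap.range B := fun u q hq hBq =>
    hstar' (Bu u) (hBurel u).1 (hBurel u).2.1 (hBurel u).2.2 q hq hBq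
  have hCex : ∀ u, ∃ C' ∈ 𝔊, ∀ x y, s (Bu u x) y = s x (C' y) := fun u => hadj _ (hBurel u).1
  choose Cu hCumem hBuCu using hCex
  have hCurel : ∀ u, Θ * Cu u = -(Cu u) ∧ Cu u * Θ = Cu u := fun u =>
    UnitaryTwoOdd.lower_of_adjoint hadd hsymm hΘΘ hP hQ hPQ hdefP hdefQ (hBurel u).2.1 (hBurel u).2.2 (hBuCu u)
  have hCuQ : ∀ u, ∀ q ∈ Q, Cu u q = 0 := fun u => hlowerQ (Cu u) (hCurel u).2
  have hCuadj' : ∀ u x y, s (Cu u y) x = s y (Bu u x) := fun u x y => by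
    rw [hsymm, ← hBuCu u, ← hsymm]
  -- `C_u` maps `P₁` into `Q₀`
  have hCuQmem : ∀ u w, Cu u w ∈ Q := fun u => hlowerval (Cu u) (hCurel u).1
  have hCuP₁ : ∀ u, ∀ x ∈ LinearMap.range B, B (Cu u x) = 0 := fun u x hx => by
    apply UnitaryTwoOdd.eq_zero_of_forall_left hadd hsymm hΘΘ hP hQ hPQ hdefP hdefQ
    intro y
    rw [hsymm, hBC, hCuadj' u, hBuval u (C y) (hCmap y), hsmulr, hP₁η x hx, mul_zero, map_zero]
  -- `C_u η = σ u` for `u ∈ Q₁`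
  have hCuη : ∀ u ∈ P.map C, Cu u η = σ • u := fun u hu => by
    rw [← sub_eq_zero]
    apply UnitaryTwoOdd.eq_zero_of_forall_left hadd hsymm hΘΘ hP hQ hPQ hdefP hdefQ
    intro x
    rw [hsubr, ← hBuCu u, hsmulr, hσreal]
    obtain ⟨a, ha, b, hb, c, hc, d, hd, rfl⟩ := hdec x
    obtain ⟨hdQ, hdB⟩ := Submodule.mem_inf.1 hd
    have hdB' : B d = 0 := LinearMap.mem_ker.1 hdB
    rw [map_add, map_add, map_add, hBuP u a (hrangeP ha), hBuP u b (Submodule.mem_inf.1 hb).1, zero_add, zero_add,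
      hBuval u c hc, hadd, hsmul, hP₁η _ (hBuQ₀ u d hdQ hdB'), add_zero, hadd, hadd, hadd,
      hPQ a (hrangeP ha) u (hQ₁Q u hu), hPQ b (Submodule.mem_inf.1 hb).1 u (hQ₁Q u hu), hQ₀Q₁ d hdQ hdB' u hu,
      ← hσdef]
    ring
  have hGval : ∀ u ∈ P.map C, ∀ v, Bu v (Cu u η) = (σ * s u v) • η := fun u hu v => by
    rw [hCuη u hu, map_smul, hBuval v u hu, smul_smul]
  -- STEP 7: a raising operator killing `Q₁` kills `Q₀`
  have hkillQ₀ : ∀ T ∈ 𝔊, Θ * T = T → T * Θ = -T → (∀ v ∈ P.map C, T v = 0) →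
      ∀ q ∈ Q, B q = 0 → T q = 0 := by
    intro T hT hΘT hTΘ hTv q hq hBq
    set y := C (T q) with hydef
    have hy : y ∈ P.map C := hCmap (T q)
    have h := hclub T hT hΘT hTΘ (Bu y) (hBurel y).1 (hBurel y).2.1 (hBurel y).2.2 q hq hBq
    rw [hTv _ (hCmap _), zero_add, ← hydef, hBuval y y hy, map_smul, hDη, smul_zero] at h
    have hsyy : s y y = 0 := (smul_eq_zero.1 h.symm).resolve_right hη0'
    have hy0 : y = 0 := hdefQU y hy hsyy
    exact hCinjR _ (hstar' T hT hΘT hTΘ q hq hBq) (by rw [← hydef, hy0])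
  -- STEP 8: the triple relation (R) on `Q₀`
  have hR : ∀ u ∈ P.map C, ∀ w ∈ P.map C, ∀ v ∈ P.map C, ∀ q ∈ Q, B q = 0 →
      Bu u (Cu w (Bu v q)) + Bu v (Cu w (Bu u q)) = (σ * s w u) • Bu v q + (σ * s w v) • Bu u q := by
    intro u hu w hw v hv q hq hBq
    set X : Module.End ℂ W := Bu u * Cu w - Cu w * Bu u with hXdef
    have hXmem : X ∈ 𝔊 := hbr _ (hBurel u).1 _ (hCumem w)
    have hXΘ : X * Θ = Θ * X := by
      rw [hXdef, sub_mul, mul_sub, mul_assoc, (hCurel w).2, mul_assoc, (hBurel u).2.2, ← mul_assoc, (hBurel u).2.1,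
        ← mul_assoc, (hCurel w).1, mul_neg, neg_mul]
    set Rr : Module.End ℂ W := X * Bu v - Bu v * X with hRrdef
    have hRrmem : Rr ∈ 𝔊 := hbr X hXmem _ (hBurel v).1
    have hΘRr : Θ * Rr = Rr := by
      rw [hRrdef, mul_sub, ← mul_assoc, ← hXΘ, mul_assoc, (hBurel v).2.1, ← mul_assoc, (hBurel v).2.1]
    have hRrΘ : Rr * Θ = -Rr := by
      rw [hRrdef, sub_mul, mul_assoc, (hBurel v).2.2, mul_assoc, hXΘ, ← mul_assoc, (hBurel v).2.2, mul_neg, neg_mul,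
        neg_sub_neg, neg_sub]
    set T : Module.End ℂ W := Rr - (σ * s w u) • Bu v - (σ * s w v) • Bu u with hTdef
    have hTmem : T ∈ 𝔊 :=
      Submodule.sub_mem _ (Submodule.sub_mem _ hRrmem (Submodule.smul_mem _ _ (hBurel v).1))
        (Submodule.smul_mem _ _ (hBurel u).1)
    have hΘT : Θ * T = T := by
      rw [hTdef, mul_sub, mul_sub, mul_smul_comm, mul_smul_comm, hΘRr, (hBurel v).2.1, (hBurel u).2.1]
    have hTΘ : T * Θ = -T := by
      rw [hTdef, sub_mul, sub_mul, smul_mul_assoc, smul_mul_assoc, hRrΘ, (hBurel v).2.2, (hBurel u).2.2]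
      module
    have hXη : X η = (σ * s w u) • η := by
      rw [hXdef, LinearMap.sub_apply, Module.End.mul_apply, Module.End.mul_apply, hGval w hw u, hBuP u η hηP,
        map_zero, sub_zero]
    have hXQ₁ : ∀ x ∈ P.map C, X x = -((s x u * σ) • w) := fun x hx => by
      rw [hXdef, LinearMap.sub_apply, Module.End.mul_apply, Module.End.mul_apply, hCuQ w x (hQ₁Q x hx), map_zero,
        zero_sub, hBuval u x hx, map_smul, hCuη w hw, smul_smul]
    have hTQ₁ : ∀ x ∈ P.map C, T x = 0 := fun x hx => by
      rw [hTdef, LinearMap.sub_apply, LinearMap.sub_apply, LinearMap.smul_apply, LinearMap.smul_apply, hRrdef,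
        LinearMap.sub_apply, Module.End.mul_apply, Module.End.mul_apply, hBuval v x hx, map_smul, hXη, hXQ₁ x hx,
        map_neg, map_smul, hBuval v w hw, hBuval u x hx]
      module
    have hTq := hkillQ₀ T hTmem hΘT hTΘ hTQ₁ q hq hBq
    have hRrq : Rr q = Bu u (Cu w (Bu v q)) + Bu v (Cu w (Bu u q)) := by
      rw [hRrdef, LinearMap.sub_apply, Module.End.mul_apply, Module.End.mul_apply, hXdef, LinearMap.sub_apply,
        LinearMap.sub_apply, Module.End.mul_apply, Module.End.mul_apply, Module.End.mul_apply, Module.End.mul_apply,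
        hBuP u _ (hBumem v q), map_zero, sub_zero, hCuQ w q hq, map_zero, zero_sub, map_neg, sub_neg_eq_add]
    rw [hTdef, LinearMap.sub_apply, LinearMap.sub_apply, LinearMap.smul_apply, LinearMap.smul_apply, hRrq] at hTq
    rw [← sub_eq_zero, ← hTq]
    abel
  -- STEP 9: the skew relation (♣) for the `B_u`, and the covering property
  have hSK : ∀ u v, ∀ q ∈ Q, B q = 0 → s (Bu v q) (B u) + s (Bu u q) (B v) = 0 := by
    intro u v q hq hBq
    have h := hclub (Bu u) (hBurel u).1 (hBurel u).2.1 (hBurel u).2.2 (Bu v) (hBurel v).1 (hBurel v).2.1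
      (hBurel v).2.2 q hq hBq
    rw [hBuval u _ (hCmap _), hBuval v _ (hCmap _), ← add_smul, map_smul, hDη, smul_zero] at h
    have h' := (smul_eq_zero.1 h.symm).resolve_right hη0'
    have e1 : s (C (Bu v q)) u = s (Bu v q) (B u) := by
      rw [hsymm u (C (Bu v q)), ← hBC u (Bu v q), ← hsymm (B u) (Bu v q)]
    have e2 : s (C (Bu u q)) v = s (Bu u q) (B v) := by
      rw [hsymm v (C (Bu u q)), ← hBC v (Bu u q), ← hsymm (B v) (Bu u q)]
    rw [← e1, ← e2]; exact h'
  have hCOV : ∀ q ∈ Q, B q = 0 → (∀ u ∈ P.map C, Bu u q = 0) → q = 0 := by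
    intro q hq hBq hkill
    refine UnitaryThetaCore.eq_zero_of_forall_raise_apply_eq_zero hbr hirr hΘ hΘΘ hP0 ((hQ q).1 hq)
      fun B' hB' hΘB' hB'Θ => ?_
    set y := C (B' q) with hydef
    have hy : y ∈ P.map C := hCmap (B' q)
    have h := hclub B' hB' hΘB' hB'Θ (Bu y) (hBurel y).1 (hBurel y).2.1 (hBurel y).2.2 q hq hBq
    rw [hkill y hy, map_zero, map_zero, zero_add, ← hydef, hBuval y y hy, map_smul, hDη, smul_zero] at h
    have hsyy : s y y = 0 := (smul_eq_zero.1 h.symm).resolve_right hη0'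
    have hy0 : y = 0 := hdefQU y hy hsyy
    exact hCinjR _ (hstar' B' hB' hΘB' hB'Θ q hq hBq) (by rw [← hydef, hy0])
  -- STEP 10: an `s`-orthogonal basis `u` of `Q₁` and the expansion of `B_{u'}` on `Q₀`
  obtain ⟨uv, huS, huorth, hune, huspan⟩ := UnitaryTriple.exists_orthogonal_basis hadd hsmul hsymm
    (Module.finrank ℂ (LinearMap.range B)) (P.map C) hfinQU hdefQU
  have hτreal : ∀ j, starRingEnd ℂ (s (uv j) (uv j)) = s (uv j) (uv j) := fun j => by rw [← hsymm]
  have hraise_sum : ∀ cf : Fin (Module.finrank ℂ (LinearMap.range B)) → ℂ,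
      (∑ j, cf j • Bu (uv j)) ∈ 𝔊 ∧ Θ * (∑ j, cf j • Bu (uv j)) = ∑ j, cf j • Bu (uv j) ∧
        (∑ j, cf j • Bu (uv j)) * Θ = -(∑ j, cf j • Bu (uv j)) := fun cf => by
    refine ⟨Submodule.sum_mem _ fun j _ => Submodule.smul_mem _ _ (hBurel _).1, ?_, ?_⟩
    · rw [Finset.mul_sum]
      exact Finset.sum_congr rfl fun j _ => by rw [mul_smul_comm, (hBurel _).2.1]
    · rw [Finset.sum_mul, ← Finset.sum_neg_distrib]
      exact Finset.sum_congr rfl fun j _ => by rw [smul_mul_assoc, (hBurel _).2.2, smul_neg]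
  have hBexp : ∀ u' ∈ P.map C, ∀ q ∈ Q, B q = 0 →
      Bu u' q = ∑ j, ((s (uv j) (uv j))⁻¹ * s (uv j) u') • Bu (uv j) q := by
    intro u' hu' q hq hBq
    obtain ⟨hSmem, hΘS, hSΘ⟩ := hraise_sum fun j => (s (uv j) (uv j))⁻¹ * s (uv j) u'
    set S := ∑ j, ((s (uv j) (uv j))⁻¹ * s (uv j) u') • Bu (uv j) with hSdef
    have hTmem : Bu u' - S ∈ 𝔊 := Submodule.sub_mem _ (hBurel u').1 hSmem
    have hΘT : Θ * (Bu u' - S) = Bu u' - S := by rw [mul_sub, hΘS, (hBurel u').2.1]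
    have hTΘ : (Bu u' - S) * Θ = -(Bu u' - S) := by rw [sub_mul, hSΘ, (hBurel u').2.2]; abel
    have hexp : ∀ x, s x u' = ∑ j, ((s (uv j) (uv j))⁻¹ * s (uv j) u') * s x (uv j) := fun x => by
      conv_lhs => rw [huspan u' hu', UnitaryTriple.sum_right hadd hsymm]
      refine Finset.sum_congr rfl fun j _ => ?_
      rw [hsmulr, map_mul, map_inv₀, hτreal, ← hsymm]
    have hTQ₁ : ∀ x ∈ P.map C, (Bu u' - S) x = 0 := fun x hx => by
      rw [LinearMap.sub_apply, hBuval u' x hx, hSdef, LinearMap.sum_apply, hexp x, Finset.sum_smul,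
        ← Finset.sum_sub_distrib]
      refine Finset.sum_eq_zero fun j _ => ?_
      rw [LinearMap.smul_apply, hBuval (uv j) x hx, smul_smul, sub_self]
    have h := hkillQ₀ _ hTmem hΘT hTΘ hTQ₁ q hq hBq
    rw [LinearMap.sub_apply, sub_eq_zero] at h
    rw [h, hSdef, LinearMap.sum_apply]
    exact Finset.sum_congr rfl fun j _ => by rw [LinearMap.smul_apply]
  
  -- STEP 11: the operators `G = Σ κⱼ C_{uⱼ} B_{uⱼ}` and `N = Σ κⱼ B_{uⱼ} C_{uⱼ}`; the Sylvester identity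
  have hτ0 : ∀ j, s (uv j) (uv j) ≠ 0 := hune
  obtain ⟨κ, hκ⟩ : ∃ κ : Fin (Module.finrank ℂ (LinearMap.range B)) → ℂ, ∀ j, κ j = (σ * s (uv j) (uv j))⁻¹ :=
    ⟨_, fun j => rfl⟩
  have hκreal : ∀ j, starRingEnd ℂ (κ j) = κ j := fun j => by rw [hκ j, map_inv₀, map_mul, hσreal, hτreal]
  have hκστ : ∀ j, κ j * (σ * s (uv j) (uv j)) = 1 := fun j => by
    rw [hκ j]; exact inv_mul_cancel₀ (mul_ne_zero hσ0 (hτ0 j))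
  have hκσ : ∀ j (c : ℂ), κ j * (σ * c) = (s (uv j) (uv j))⁻¹ * c := fun j c => by
    rw [hκ j, mul_inv, mul_mul_mul_comm, inv_mul_cancel₀ hσ0, one_mul]
  have hconj : starRingEnd ℂ ((Module.finrank ℂ (LinearMap.range B) : ℂ) + 1) =
      (Module.finrank ℂ (LinearMap.range B) : ℂ) + 1 := by rw [map_add, map_natCast, map_one]
  obtain ⟨GW, hGWdef⟩ : ∃ GW : Module.End ℂ W, GW = ∑ j, κ j • (Cu (uv j) * Bu (uv j)) := ⟨_, rfl⟩
  obtain ⟨NW, hNWdef⟩ : ∃ NW : Module.End ℂ W, NW = ∑ j, κ j • (Bu (uv j) * Cu (uv j)) := ⟨_, rfl⟩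
  have hGWapply : ∀ q, GW q = ∑ j, κ j • Cu (uv j) (Bu (uv j) q) := fun q => by
    rw [hGWdef, LinearMap.sum_apply]
    exact Finset.sum_congr rfl fun j _ => by rw [LinearMap.smul_apply, Module.End.mul_apply]
  have hNWapply : ∀ x, NW x = ∑ j, κ j • Bu (uv j) (Cu (uv j) x) := fun x => by
    rw [hNWdef, LinearMap.sum_apply]
    exact Finset.sum_congr rfl fun j _ => by rw [LinearMap.smul_apply, Module.End.mul_apply]
  have hGWQ₀ : ∀ q ∈ Q, B q = 0 → GW q ∈ Q ∧ B (GW q) = 0 := fun q hq hBq => by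
    have hmem : GW q ∈ Q ⊓ LinearMap.ker B := by
      rw [hGWapply]
      exact Submodule.sum_mem _ fun j _ => Submodule.smul_mem _ _ (Submodule.mem_inf.2
        ⟨hCuQmem _ _, LinearMap.mem_ker.2 (hCuP₁ _ _ (hBuQ₀ _ q hq hBq))⟩)
    exact ⟨(Submodule.mem_inf.1 hmem).1, LinearMap.mem_ker.1 (Submodule.mem_inf.1 hmem).2⟩
  have hNWP₁ : ∀ x ∈ LinearMap.range B, NW x ∈ LinearMap.range B := fun x hx => by
    rw [hNWapply]
    exact Submodule.sum_mem _ fun j _ => Submodule.smul_mem _ _ (hBuQ₀ _ _ (hCuQmem _ _) (hCuP₁ _ x hx))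
  have hSyl : ∀ u' ∈ P.map C, ∀ q ∈ Q, B q = 0 →
      NW (Bu u' q) + Bu u' (GW q) = ((Module.finrank ℂ (LinearMap.range B) : ℂ) + 1) • Bu u' q := by
    intro u' hu' q hq hBq
    have hterm : ∀ j, κ j • Bu (uv j) (Cu (uv j) (Bu u' q)) + κ j • Bu u' (Cu (uv j) (Bu (uv j) q)) =
        Bu u' q + ((s (uv j) (uv j))⁻¹ * s (uv j) u') • Bu (uv j) q := fun j => by
      rw [← smul_add, hR (uv j) (huS j) (uv j) (huS j) u' hu' q hq hBq, smul_add, smul_smul, smul_smul, hκστ j,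
        one_smul, hκσ]
    calc NW (Bu u' q) + Bu u' (GW q)
        = ∑ j, (κ j • Bu (uv j) (Cu (uv j) (Bu u' q)) + κ j • Bu u' (Cu (uv j) (Bu (uv j) q))) := by
          rw [hNWapply, hGWapply, map_sum, ← Finset.sum_add_distrib]
          exact Finset.sum_congr rfl fun j _ => by rw [map_smul]
      _ = ∑ j, (Bu u' q + ((s (uv j) (uv j))⁻¹ * s (uv j) u') • Bu (uv j) q) := Finset.sum_congr rfl fun j _ => hterm j
      _ = ((Module.finrank ℂ (LinearMap.range B) : ℂ) + 1) • Bu u' q := by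
          rw [Finset.sum_add_distrib, Finset.sum_const, Finset.card_univ, Fintype.card_fin,
            ← hBexp u' hu' q hq hBq, add_smul, one_smul, Nat.cast_smul_eq_nsmul]
  have hGWadj : ∀ x y, s (GW x) y = s x (GW y) := fun x y => by
    rw [hGWapply, hGWapply, UnitaryTriple.sum_left hadd hsymm, UnitaryTriple.sum_right hadd hsymm]
    refine Finset.sum_congr rfl fun j _ => ?_
    rw [hsmul, hsmulr, hκreal, hCuadj', ← hBuCu]
  have hNWadj : ∀ x y, s (NW x) y = s x (NW y) := fun x y => by
    rw [hNWapply, hNWapply, UnitaryTriple.sum_left hadd hsymm, UnitaryTriple.sum_right hadd hsymm]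
    refine Finset.sum_congr rfl fun j _ => ?_
    rw [hsmul, hsmulr, hκreal, hBuCu, ← hCuadj']
  -- STEP 12: the block operators on `Q₀ = Q ∩ ker B` and `P₁ = B(W)`, and an eigenvector of `G`
  set Q₀S : Submodule ℂ W := Q ⊓ LinearMap.ker B with hQ₀Sdef
  have hQ₀S : ∀ q, q ∈ Q₀S ↔ q ∈ Q ∧ B q = 0 := fun q => by
    rw [hQ₀Sdef, Submodule.mem_inf, LinearMap.mem_ker]
  have hQ₀S' : ∀ q : Q₀S, (q : W) ∈ Q ∧ B q = 0 := fun q => (hQ₀S q).1 q.2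
  obtain ⟨bb, hbb⟩ : ∃ bb : Fin (Module.finrank ℂ (LinearMap.range B)) → (↥Q₀S →ₗ[ℂ] ↥(LinearMap.range B)),
      ∀ j (q : Q₀S), ((bb j q : LinearMap.range B) : W) = Bu (uv j) q :=
    ⟨fun j => LinearMap.codRestrict (LinearMap.range B) (Bu (uv j) ∘ₗ Q₀S.subtype)
      (fun q => hBuQ₀ _ q (hQ₀S' q).1 (hQ₀S' q).2), fun j q => rfl⟩
  obtain ⟨cc, hcc⟩ : ∃ cc : Fin (Module.finrank ℂ (LinearMap.range B)) → (↥(LinearMap.range B) →ₗ[ℂ] ↥Q₀S),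
      ∀ j (x : LinearMap.range B), ((cc j x : Q₀S) : W) = κ j • Cu (uv j) x :=
    ⟨fun j => κ j • LinearMap.codRestrict Q₀S (Cu (uv j) ∘ₗ (LinearMap.range B).subtype)
      (fun x => (hQ₀S _).2 ⟨hCuQmem _ _, hCuP₁ _ x x.2⟩), fun j x => rfl⟩
  have hfinQ₀S : Module.finrank ℂ ↥Q₀S + Module.finrank ℂ (LinearMap.range B) = Module.finrank ℂ Q := hfinQ₀
  haveI : Nontrivial ↥Q₀S := Module.nontrivial_of_finrank_pos (R := ℂ) (by omega)
  have hGblkapply : ∀ q : Q₀S, (((∑ j, cc j ∘ₗ bb j) q : Q₀S) : W) = GW q := fun q => by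
    rw [LinearMap.sum_apply, Submodule.coe_sum, hGWapply]
    exact Finset.sum_congr rfl fun j _ => by rw [LinearMap.comp_apply, hcc, hbb]
  obtain ⟨γ, hγ⟩ := Module.End.exists_eigenvalue (∑ j, cc j ∘ₗ bb j)
  obtain ⟨q₀, hq₀⟩ := hγ.exists_hasEigenvector
  have hq₀eq : GW q₀ = γ • (q₀ : W) := by rw [← hGblkapply, hq₀.apply_eq_smul, Submodule.coe_smul]
  have hq₀ne : (q₀ : W) ≠ 0 := fun h => hq₀.2 (Subtype.ext h)
  have hγreal : starRingEnd ℂ γ = γ := by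
    have h := hGWadj q₀ q₀
    rw [hq₀eq, hsmul, hsmulr] at h
    have hqq : s (q₀ : W) q₀ ≠ 0 := fun h0 => hq₀ne (hdefQ _ (hQ₀S' q₀).1 h0)
    exact (mul_right_cancel₀ hqq h).symm
  have hγconj : starRingEnd ℂ (((Module.finrank ℂ (LinearMap.range B) : ℂ) + 1) - γ) =
      ((Module.finrank ℂ (LinearMap.range B) : ℂ) + 1) - γ := by rw [map_sub, hconj, hγreal]
  have hNWeig : ∀ k, ∀ q ∈ Q, B q = 0 → GW q = γ • q →
      NW (Bu (uv k) q) = (((Module.finrank ℂ (LinearMap.range B) : ℂ) + 1) - γ) • Bu (uv k) q := by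
    intro k q hq hBq hGq
    have h := hSyl (uv k) (huS k) q hq hBq
    rw [hGq, map_smul] at h
    rw [sub_smul]
    exact eq_sub_of_add_eq h
  -- STEP 13 (the eigenvector lemma): no non-zero vector of `P₁` is `s`-orthogonal to all `B_{u_k} q`, `q ∈ M_γ`
  have hX : ∀ x ∈ LinearMap.range B,
      (∀ k, ∀ q ∈ Q, B q = 0 → GW q = γ • q → s (Bu (uv k) q) x = 0) → x = 0 := by
    intro x hx horth
    by_contra hx0
    obtain ⟨w, rfl⟩ := hx
    obtain ⟨a, ha, b', hb', u, hu, d, hd, hw⟩ := hdec w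
    have hBu : B w = B u := by
      rw [hw, map_add, map_add, map_add, hBP a (hrangeP ha), hBP b' (Submodule.mem_inf.1 hb').1,
        LinearMap.mem_ker.1 (Submodule.mem_inf.1 hd).2, zero_add, zero_add, add_zero]
    have hu0 : u ≠ 0 := fun h => hx0 (by rw [hBu, h, map_zero])
    have hsuu : s u u ≠ 0 := fun h => hu0 (hdefQU u hu h)
    -- (i) `B_u` kills `M_γ`
    have hi : ∀ q ∈ Q, B q = 0 → GW q = γ • q → Bu u q = 0 := by
      intro q hq hBq hGq
      have hzorth : ∀ k, s (Bu u q) (B (uv k)) = 0 := fun k => by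
        have h := hSK (uv k) u q hq hBq
        rw [← hBu, horth k q hq hBq hGq, add_zero] at h
        exact h
      have hzP₁ : ∀ z' ∈ LinearMap.range B, s (Bu u q) z' = 0 := by
        rintro _ ⟨w', rfl⟩
        obtain ⟨a', ha', b'', hb'', c', hc', d', hd', hw'⟩ := hdec w'
        have hBw' : B w' = B c' := by
          rw [hw', map_add, map_add, map_add, hBP a' (hrangeP ha'), hBP b'' (Submodule.mem_inf.1 hb'').1,
            LinearMap.mem_ker.1 (Submodule.mem_inf.1 hd').2, zero_add, zero_add, add_zero]
        rw [hBw', huspan c' hc', map_sum, UnitaryTriple.sum_right hadd hsymm]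
        refine Finset.sum_eq_zero fun j _ => ?_
        rw [map_smul, hsmulr, hzorth j, mul_zero]
      exact hdefP _ (hBumem u q) (hzP₁ _ (hBuQ₀ u q hq hBq))
    -- the adjoint Sylvester identity for `C_u`
    have hSylAdj : ∀ y ∈ LinearMap.range B,
        Cu u (NW y) + GW (Cu u y) = ((Module.finrank ℂ (LinearMap.range B) : ℂ) + 1) • Cu u y := by
      intro y hy
      have hv1 : Cu u (NW y) ∈ Q ∧ B (Cu u (NW y)) = 0 := ⟨hCuQmem _ _, hCuP₁ u _ (hNWP₁ y hy)⟩
      have hv2 : GW (Cu u y) ∈ Q ∧ B (GW (Cu u y)) = 0 := hGWQ₀ (Cu u y) (hCuQmem u y) (hCuP₁ u y hy)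
      have hv3 : Cu u y ∈ Q ∧ B (Cu u y) = 0 := ⟨hCuQmem u y, hCuP₁ u y hy⟩
      have hpair : ∀ q' ∈ Q, B q' = 0 →
          s q' (Cu u (NW y) + GW (Cu u y) - (((Module.finrank ℂ (LinearMap.range B) : ℂ)) + 1) • Cu u y) = 0 := by
        intro q' hq' hBq'
        have e1 : s q' (Cu u (NW y)) = s (NW (Bu u q')) y := by rw [← hBuCu u q' (NW y), ← hNWadj]
        have e2 : s q' (GW (Cu u y)) = s (Bu u (GW q')) y := by rw [← hGWadj q' (Cu u y), ← hBuCu u (GW q') y]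
        have e3 : s q' ((((Module.finrank ℂ (LinearMap.range B) : ℂ)) + 1) • Cu u y) =
            (((Module.finrank ℂ (LinearMap.range B) : ℂ)) + 1) * s (Bu u q') y := by
          rw [hsmulr, ← hBuCu u q' y, hconj]
        rw [hsubr, haddr, e1, e2, e3, ← hadd, hSyl u hu q' hq' hBq', hsmul, sub_self]
      have hvQ : Cu u (NW y) + GW (Cu u y) - (((Module.finrank ℂ (LinearMap.range B) : ℂ)) + 1) • Cu u y ∈ Q :=
        Submodule.sub_mem _ (Submodule.add_mem _ hv1.1 hv2.1) (Submodule.smul_mem _ _ hv3.1)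
      have hvB : B (Cu u (NW y) + GW (Cu u y) - (((Module.finrank ℂ (LinearMap.range B) : ℂ)) + 1) • Cu u y) = 0 := by
        rw [map_sub, map_add, map_smul, hv1.2, hv2.2, hv3.2, smul_zero, add_zero, sub_zero]
      exact sub_eq_zero.1 (hdefQ _ hvQ (hpair _ hvQ hvB))
    -- (ii) `C_u (B_{u_k} q) = 0` for `q ∈ M_γ`
    have hii : ∀ k, ∀ q ∈ Q, B q = 0 → GW q = γ • q → Cu u (Bu (uv k) q) = 0 := by
      intro k q hq hBq hGq
      have hy : Bu (uv k) q ∈ LinearMap.range B := hBuQ₀ _ q hq hBq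
      have hzQ : Cu u (Bu (uv k) q) ∈ Q := hCuQmem u _
      have hzB : B (Cu u (Bu (uv k) q)) = 0 := hCuP₁ u _ hy
      have hGz : GW (Cu u (Bu (uv k) q)) = γ • Cu u (Bu (uv k) q) := by
        have h1 := hSylAdj _ hy
        rw [hNWeig k q hq hBq hGq, map_smul] at h1
        rw [eq_sub_of_add_eq' h1, ← sub_smul]
        congr 1
        ring
      have hzz : s (Cu u (Bu (uv k) q)) (Cu u (Bu (uv k) q)) = 0 := by
        rw [hCuadj' u (Cu u (Bu (uv k) q)) (Bu (uv k) q), hi _ hzQ hzB hGz, h0r]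
      exact hdefQ _ hzQ hzz
    -- (iii) every `q ∈ M_γ` vanishes — contradicting `q₀ ≠ 0`
    have hiii : ∀ q ∈ Q, B q = 0 → GW q = γ • q → q = 0 := by
      intro q hq hBq hGq
      have hk : ∀ k, Bu (uv k) q = 0 := fun k => by
        have h := hR (uv k) (huS k) u hu u hu q hq hBq
        rw [hi q hq hBq hGq, map_zero, map_zero, zero_add, hii k q hq hBq hGq, map_zero, smul_zero, zero_add] at h
        exact (smul_eq_zero.1 h.symm).resolve_left (mul_ne_zero hσ0 hsuu)
      refine hCOV q hq hBq fun u' hu' => ?_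
      rw [hBexp u' hu' q hq hBq]
      exact Finset.sum_eq_zero fun j _ => by rw [hk j, smul_zero]
    exact hq₀ne (hiii q₀ (hQ₀S' q₀).1 (hQ₀S' q₀).2 hq₀eq)
  -- STEP 14: `N = ν` on `P₁` and `G = γ` on `Q₀`
  have hNW : ∀ x ∈ LinearMap.range B, NW x = (((Module.finrank ℂ (LinearMap.range B) : ℂ) + 1) - γ) • x := by
    intro x hx
    rw [← sub_eq_zero]
    refine hX _ (Submodule.sub_mem _ (hNWP₁ x hx) (Submodule.smul_mem _ _ hx)) fun k q hq hBq hGq => ?_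
    rw [hsubr, hsmulr, ← hNWadj, hNWeig k q hq hBq hGq, hsmul, hγconj, sub_self]
  have hGW : ∀ q ∈ Q, B q = 0 → GW q = γ • q := by
    intro q hq hBq
    have hk : ∀ k, Bu (uv k) (GW q - γ • q) = 0 := fun k => by
      have h := hSyl (uv k) (huS k) q hq hBq
      rw [hNW _ (hBuQ₀ _ q hq hBq)] at h
      rw [map_sub, map_smul, eq_sub_of_add_eq' h, ← sub_smul, sub_sub_cancel, sub_self]
    have hmem := hGWQ₀ q hq hBq
    have hdQ : GW q - γ • q ∈ Q := Submodule.sub_mem _ hmem.1 (Submodule.smul_mem _ _ hq)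
    have hdB : B (GW q - γ • q) = 0 := by rw [map_sub, map_smul, hmem.2, hBq, smul_zero, sub_zero]
    refine sub_eq_zero.1 (hCOV _ hdQ hdB fun u' hu' => ?_)
    rw [hBexp u' hu' _ hdQ hdB]
    exact Finset.sum_eq_zero fun j _ => by rw [hk j, smul_zero]
  -- STEP 15: the rank identity and the arithmetic contradiction
  have hrelblk : ∀ j k, bb j ∘ₗ cc j ∘ₗ bb k + bb k ∘ₗ cc j ∘ₗ bb j = if j = k then (2 : ℂ) • bb k else bb k := by
    intro j k
    apply LinearMap.ext
    intro q
    apply Subtype.ext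
    have hq := hQ₀S' q
    rw [LinearMap.add_apply, Submodule.coe_add, LinearMap.comp_apply, LinearMap.comp_apply, LinearMap.comp_apply,
      LinearMap.comp_apply, hbb, hcc, hbb, hbb, hcc, hbb, map_smul, map_smul, ← smul_add,
      hR (uv j) (huS j) (uv j) (huS j) (uv k) (huS k) q hq.1 hq.2, smul_add, smul_smul, smul_smul, hκστ j, one_smul]
    split_ifs with hjk
    · subst hjk
      rw [hκστ j, one_smul, LinearMap.smul_apply, Submodule.coe_smul, hbb, two_smul]
    · rw [huorth j k hjk, mul_zero, mul_zero, zero_smul, add_zero, hbb]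
  have hGblk : ∑ j, cc j ∘ₗ bb j = γ • LinearMap.id := by
    apply LinearMap.ext
    intro q
    apply Subtype.ext
    rw [hGblkapply, LinearMap.smul_apply, LinearMap.id_apply, Submodule.coe_smul]
    exact hGW q (hQ₀S' q).1 (hQ₀S' q).2
  have hNblk : ∑ j, bb j ∘ₗ cc j = (((Module.finrank ℂ (LinearMap.range B) : ℂ) + 1) - γ) • LinearMap.id := by
    apply LinearMap.ext
    intro x
    apply Subtype.ext
    rw [LinearMap.sum_apply, Submodule.coe_sum, LinearMap.smul_apply, LinearMap.id_apply, Submodule.coe_smul,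
      ← hNW x x.2, hNWapply]
    exact Finset.sum_congr rfl fun j _ => by rw [LinearMap.comp_apply, hbb, hcc, map_smul]
  set j₀ : Fin (Module.finrank ℂ (LinearMap.range B)) := ⟨0, by omega⟩ with hj₀def
  have hE0 : cc j₀ ∘ₗ bb j₀ ≠ 0 := by
    intro h0
    have hB0 : ∀ q ∈ Q, B q = 0 → Bu (uv j₀) q = 0 := by
      intro q hq hBq
      have h1 : κ j₀ • Cu (uv j₀) (Bu (uv j₀) q) = 0 := by
        have h := congrArg (fun f => (((f ⟨q, (hQ₀S q).2 ⟨hq, hBq⟩⟩ : Q₀S) : W))) h0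
        simpa only [LinearMap.comp_apply, hcc, hbb, LinearMap.zero_apply, Submodule.coe_zero] using h
      have h2 : Cu (uv j₀) (Bu (uv j₀) q) = 0 :=
        (smul_eq_zero.1 h1).resolve_left (by rw [hκ j₀]; exact inv_ne_zero (mul_ne_zero hσ0 (hτ0 j₀)))
      have h3 : s (Bu (uv j₀) q) (Bu (uv j₀) q) = 0 := by rw [← hCuadj', h2, h0l]
      exact hdefP _ (hBumem _ q) h3
    have hall : ∀ q ∈ Q, B q = 0 → q = 0 := by
      intro q hq hBq
      refine hCOV q hq hBq fun u' hu' => ?_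
      have h := hR u' hu' (uv j₀) (huS j₀) (uv j₀) (huS j₀) q hq hBq
      rw [hB0 q hq hBq, map_zero, map_zero, zero_add, smul_zero, zero_add,
        hB0 _ (hCuQmem _ _) (hCuP₁ _ _ (hBuQ₀ u' q hq hBq))] at h
      exact (smul_eq_zero.1 h.symm).resolve_left (mul_ne_zero hσ0 (hτ0 j₀))
    exact hq₀ne (hall q₀ (hQ₀S' q₀).1 (hQ₀S' q₀).2)
  set H : Submodule ℂ ↥(LinearMap.range B) := LinearMap.ker ((sℓ (B (uv j₀))) ∘ₗ (LinearMap.range B).subtype)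
    with hHdef
  have hHmem : ∀ x : LinearMap.range B, x ∈ H ↔ s (x : W) (B (uv j₀)) = 0 := fun x => by
    rw [hHdef, LinearMap.mem_ker, LinearMap.comp_apply, Submodule.subtype_apply, hsℓ]
  have hH : LinearMap.range (bb j₀) ≤ H := by
    rintro _ ⟨q, rfl⟩
    rw [hHmem, hbb]
    have h := hSK (uv j₀) (uv j₀) q (hQ₀S' q).1 (hQ₀S' q).2
    exact add_self_eq_zero.1 h
  have hBu0 : B (uv j₀) ≠ 0 := fun h => by
    obtain ⟨p, hp, hpu⟩ := huS j₀
    have h' : uv j₀ = 0 := by rw [← hpu] at h ⊢; exact hpos1 p hp h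
    exact hτ0 j₀ (by rw [h', h0l])
  have hHne : H ≠ ⊤ := fun htop => by
    have hmem : (⟨B (uv j₀), ⟨uv j₀, rfl⟩⟩ : LinearMap.range B) ∈ H := htop ▸ Submodule.mem_top
    rw [hHmem] at hmem
    exact hBu0 (hdefP _ (hBmem _) hmem)
  have hHr : Module.finrank ℂ H < Module.finrank ℂ (LinearMap.range B) := Submodule.finrank_lt hHne
  obtain ⟨ρ, hρ1, hρr, hρeq⟩ := UnitaryTriple.rank_identity bb cc hrelblk hGblk hNblk rfl j₀ hE0 H hH hHr
  have hm : Module.finrank ℂ Q - Module.finrank ℂ (LinearMap.range B) = Module.finrank ℂ ↥Q₀S := by omega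
  exact hno ρ hρ1 hρr (by rw [hm]; exact hρeq)

end HodgeStructure

end Literature.AlgebraicGeometry.Motives

end
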